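import Literature.MathematicalPhysics.QuantumFieldTheory.Balaban1983to89.B7Prop1Explicit
import Literature.MathematicalPhysics.QuantumFieldTheory.Balaban1983to89.BlockAveragingExpMeanLog

/-!
# Bałaban's renormalization group for 4-d lattice Yang–Mills — B7 Proposition 3 (121)–(126) AT THE FLAT BACKGROUND
`V₀ = 1`: the "double-bar" average (89) of Sect. C for the concrete block average (42) on `ℤ^d`, its first-order term
= the main term (125) `L·(Q₀A)_c = Σ_{x∈B(c₋)} L^{−d} A([x, x′])`, the remainder bound (123) with explicit
`C₁(d) = 1256(d+1)²`, and (v1.1, §5) the ANALYTICITY of `Q(1, A) = (1/i) log V̿₁` in `A` (`B7Prop3Flat`)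

CITATION HEADER (lean-in-tree rule 2026-08-18).  Audit cell `pub-balaban`, paper sub-cell B07 (unit b2b-balaban-b07,
gen 16; v1.3.1 / v1.3.2 docstring revisions gens 17 / 18).  Source: T. Bałaban, *Averaging operations for lattice gauge theories*, Commun. Math. Phys. **98**, 17–51
(1985) [Balaban1985Averaging] (cell paper B7; journal page = PDF page + 16), Sect. C–D pp. 27–36 [PDF 11–20], quoted
from the page renders `b2b-balaban-ref1/pages/1985-cmp98-averaging/1985-cmp98-averaging-p011-x2.png`, `-p012-x2.png`,
`-p014-x2.png`, `-p015-x2.png`, `-p016-x2.png`, `-p018-x2.png`, `-p019-x2.png`, `-p020-x2.png` READ AS IMAGES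
(2026-08-19).
Companions: `B7Prop1Explicit` (the concrete average (42) `bavg`, the contours `treeWord`/`seg`/`gammaWord`, the
abelian path functional `asum`, the one-side expansion `side_estimate`, all REUSED here — the only import of v1;
v1.1 adds `BlockAveragingExpMeanLog` for the analyticity of the series log, `ExpMeanLog.analyticAt_mlog`), `B7Transfer` §1 (the ABSTRACT double-bar recipe `dbar` (89) and the factorisation (92)/(97); `dbavg_eq_dbar`
below identifies the present concrete object as its instance with `σ = id`), `MatrixLog` (the series (21) `mlog`,
(26) `norm_mlog_le_two_mul`), `B7` (the quoted leaf `B7.Prop3Printed`, NOT discharged here — see DIVERGENCES (a)).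

THE PRINTED TEXT.  p. 27 (58): "(R_{0,y}V′)(Γ_{y,x}) = ∏_{b⊂Γ_{y,x}} R(V₀(Γ_{y,b₋}))V′_b", (56) "R(X)Y = XYX⁻¹".
p. 28 (62): "v(y) = exp[−i Σ_{x∈B(y)} L^{−d} (1/i) log(R_{0,y}V₁)(Γ_{y,x})]", (63): "V̄_c(V̄₀)_c⁻¹ =
exp[−i Σ_{x∈B(c₋)} L^{−d} (1/i) log(R_{0,c₋}V₁)(Γ_{c₋,x})] (\overline{V₁V₀})_c(V̄₀)_c⁻¹ · R̄_{0,c} exp[i Σ_{x′∈B(c₊)}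
L^{−d} (1/i) log(R_{0,c₊}V₁)(Γ_{c₊,x′})]", and above (61): "a good approximation of the function
(1/i) log(\overline{V′V₀})_c(V̄₀)_c⁻¹ for V′ = e^{iA}, A small, is given by (Q₀A)(c) = Σ_{x∈B(c₋)} L^{−d}(R_{0,c₋}A)([x, x(c)]),
where R_{0,c₋}A is defined as R_{0,c₋}V′, only the product over b is replaced by the sum."  p. 30 (82):
"(R̄₀u)(x₁) = u(x₁)(\overline{R_{0,x₁}U₁})(Γ_{x₁,·}) = u(x₁)\overline{R_{0,x₁}U₁}".  p. 31 (89):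
"(\overline{R(V₀)V₁})_c = (\overline{R_{0,c₋}V₁})⁻¹ (\overline{V₁V₀})_c (V̄₀)_c⁻¹ R̄_{0,c} \overline{R_{0,c₊}V₁} =
(\overline{R_{0,c₋}V₁})⁻¹ Ṽ₁ R̄_{0,c} \overline{R_{0,c₊}V₁}", (90) "U̿₁ = \overline{R(U₀)U₁}", (92) at `k = 1`; p. 32 (97) at
`j = 1`: "(Ũ₁^j)_b = v_j(b₋)(U̿₁^j)_b R̄^j_{0,b} v_j⁻¹(b₊) = (U̿₁^j)_b^{v_j}, v_j(x) = (\overline{R_{0,x}U₁})…"; p. 31, after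
(91): "Let us remark that these averages have the same locality properties as the averages Ū^k, namely (Ū^k)_c,
c ⊂ Ω^{(k)}, depends on the variables U_b for b ⊂ B^k(c₋)∪B^k(c₊)."  p. 34: "Let us recall that the definition of
(U̿₁^k)_c, c ⊂ Ω^{(k)}, involves only the gauge fields U_{1,b}, U_{0,b} at bonds b ⊂ B^k(c₋)∪B^k(c₊). Let us start with a
detailed analysis of the one-step averaging operation V̿₁. We assume that the configurations V₀, V₁ satisfy the
conditions |V₀(∂p) − 1| < α₀, V_{1,b} = e^{iA_b}, |A_b| < α₁, p, b ⊂ Ω′, (109) and A_b belong to the complexified Lie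
algebra 𝔤^c. We would like to prove that for α₀, α₁ sufficiently small the average (V̿₁)_c is an analytic function of
the variables A_b, b ⊂ B(c₋)∪B(c₊), c ⊂ Ω′^{(1)}, and to find bounds for (V̿₁)_c − 1, or rather (1/i) log(V̿₁)_c. We assume
that α₀ is so small that the Propositions 1 and 2 hold, i.e., α₀ ≤ c₂." (p. 20: "For a function F(A) defined on the
complexified algebra, a notion of analyticity is well defined and means analyticity with respect to complex variables
A_a", the coordinates of `A = Σ_a A_a t_a ∈ 𝔤^c` in a basis `{t_a}` of `𝔤`; "Another important property is an analyticity
of a result of the averaging operation with respect to an averaged field.")  (110): "\overline{R_{0,y}V₁} = exp[i Σ_{x∈B(y)} L^{−d}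
(1/i) log(R_{0,y}V₁)(Γ_{y,x})], y ∈ Ω′^{(1)}", (111): "(1/i) log(R_{0,y}V₁)(Γ_{y,x}) = (R_{0,y}A)(Γ_{y,x}) +
O((|A|(Γ_{y,x}))²)", (112): "\overline{R_{0,y}V₁} = exp[i Σ_{x∈B(y)} L^{−d}(R_{0,y}A)(Γ_{y,x}) + O(L²α₁²)]".  p. 35 (120):
"(V̿₁)_c = (\overline{R_{0,c₋}V₁})⁻¹(Ṽ₁)_c R̄_{0,c} \overline{R_{0,c₊}V₁} = exp[−i Σ_{x∈B(c₋)} L^{−d}(R_{0,c₋}A)(Γ_{c₋,x})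
+ i(Q′(V₀)A)_c + i Σ_{x′∈B(c₊)} L^{−d} R̄_{0,c}(R_{0,c₊}A)(Γ_{c₊,x′}) + O(L²α₁²)]".  p. 36: "Let us define
Q(V₀, A, c) = (1/i) log(V̿₁)_c, (121) then Q(V₀, A, c) is an analytic function of A and from (120) it follows that its
Taylor expansion begins with a first-order polynomial. Let us denote it by L(Q(V₀)A)_c. Thus we have
Q(V₀, A, c) = L(Q(V₀)A)_c + C(V₀, A, c). (122)  C(V₀, A, c) is an analytic function of A whose Taylor's expansion
begins with a second-order polynomial (a quadratic form), and |C(V₀, A, c)| ≤ C₁L²|A|² < C₁(Lα₁)². (123)"; (124) =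
the five-term linear form; "The first term on the right-hand side above is the main term in this linear form … The
remaining terms are small because the functions g(−z), g⁻¹(z), e^{iz} are equal to 1 for z = 0, so the operators
occurring in these terms can be estimated by O(L²α₀) … We will denote the main term by Q_{V₀}, or Q₀
(Q₀A)_c = (Q_{V₀}A)_c = Σ_{x∈B(c₋)} L^{−(d+1)}(R_{0,c₋}A)([x, x′]), (125) and it has an estimate |(Q₀A)_c| ≤ |A| < α₁,
… |(Q(V₀)A)_c| ≤ |A| + O(1)L²α₀|A| < (1 + O(1)L²α₀)α₁ (126)…  **Proposition 3.** There exist constants C₁, c₃,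
c₃ ≤ c₂, such that for α₀, α₁ ≤ c₃ the function Q(V₀, A) = (1/i) log V̿₁ is an analytic function of A satisfying the
equalities and bounds (122)–(124). The constant C₁ depends on d and c₃ depends on d and L."
READING of (122) (cell census C-adv4-22, recorded in the docstring of `B7.Prop3Printed`): «L(Q(V₀)A)_c» = L·(Q(V₀)A)_c
with L the block size; the linear part of Q is L·(Q(V₀)A)_c, (125)/(126) bound the L^{−(d+1)}-normalised form.
CELL SHORTHAND (this file's notation, NOT a printed symbol; XREAD C-pv14-88 Q1, C-pv05g13-3 Q1′): `𝔤^c(c₃)` := the set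
of bond fields `A = (A_b)`, `A_b ∈ 𝔤^c`, with `|A_b| < c₃` on the bonds `b ⊂ B(c₋) ∪ B(c₊)` — the domain (109) with
`α₁ = c₃`, the largest value Prop. 3 admits ("for α₀, α₁ ≤ c₃"); print itself writes only `𝔤^c` (pp. 20, 34) and
"an analytic function of A" (Prop. 3) / "of the variables A_b, b ⊂ B(c₋)∪B(c₊)" (p. 34).

THE FLAT BACKGROUND.  For `V₀ = 1`: `R(V₀(Γ)) = id` (56), so `(R_{0,y}V₁)(Γ_{y,x}) = V₁(Γ_{y,x})` (58) and
`R_{0,c₋}A = A`; `V̄₀ = 1` ((42) of the unit configuration: every `log` vanishes), `R̄_{0,c} = R((V̄₀)_c) = id` (59),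
`Ṽ₁ = (\overline{V₁V₀})_c(V̄₀)_c⁻¹ = V̄₁(c)` — the average (42) of `V₁` itself; `α₀ = 0`, `Y_x = 0`, `Y = 0`, the operators
`g(∓i ad_Y)`, `e^{±i ad_Y}` of (116)–(124) are the identity and (124) REDUCES TO ITS FIRST TERM (125).  Hence, at `V₀ = 1`:
(110) `v(y) := \overline{R_{0,y}V₁} = exp[Σ_{x∈B(y)} L^{−d} log V₁(Γ_{y,x})]`; (89)/(120) `V̿₁(c) = v(c₋)⁻¹ V̄₁(c) v(c₊)`;
(121)–(123)+(125) `(1/i) log V̿₁(c) = L·(Q₀A)_c + C(1, A, c)`, `|C| ≤ C₁L²|A|²`.  MECHANISM of (125) at `V₀ = 1` (print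
does not spell it out; it is the `Y = 0` case of (115)–(120)): to first order `V̄₁(c) − 1 ≈ Σ_x L^{−d} A(Γ_{c,x})`,
`A(Γ_{c,x}) = A(Γ_{c₋,x}) + A([x, x′]) − A(Γ_{c₊,x′})` ((14)), while `v(c₋)⁻¹ − 1 ≈ −Σ_x L^{−d} A(Γ_{c₋,x})` and
`v(c₊) − 1 ≈ +Σ_{x′} L^{−d} A(Γ_{c₊,x′})`: the tree-contour terms CANCEL against the frames and only the straight
segments `[x, x′]`, `x′ = x + Le_κ`, survive (`frame_cancellation`, an identity of formal sums).

DICTIONARY print ↦ Lean (`𝔸` a complete normed `ℂ`-algebra standing for `M_N(ℂ)`; the `i` of `e^{iA}` absorbed into `A`;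
the objects of `B7Prop1Explicit`: sites `Site d = ℤ^d`, `hol`, `treeWord`, `seg`, `gammaWord`, `boxVec`, `asum`, (42)
`bavg L V q κ = V̄_c` for the `L`-bond `c = ⟨q, q + Le_κ⟩`, `B(c₋) = q + [0, L)^d`, `c₊ = q + Le_κ`).  (110) at `V₀ = 1`
↦ `Favg L V q` (the exponent) and `vframe L V q = v(q) := \overline{R_{0,q}V₁}` — CAUTION (XREAD C-pv26g9-7 A1): this
`v` is the block frame \overline{R_{0,y}V₁} of (110)/(89) (and the `v_j` of (97)), i.e. the INVERSE of the gauge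
transformation `v(y) = exp[−i Σ …] = (\overline{R_{0,y}V₁})⁻¹` that print calls `v(y)` in (62); (89)/(120) ↦
`dbavg L V q κ = V̿₁(c)`; the linearisation of
(110), i.e. the exponent of (112), ↦ `Fhat L A q = Σ_x L^{−d} A(Γ_{q,x})`; `L·(Q₀A)_c` ↦ `linQ L A q κ`; (125)
`(Q₀A)_c` ↦ `Q0form L A q κ` (`linQ = L • Q0form`, `linQ_eq_smul_Q0form`); (121) `Q(1, A, c)` ↦ `mlog (dbavg L V q κ)`
with `V = V₁ = e^{A}` bondwise (`expCfg A`); `|A| = sup_b |A_b|` ↦ a bound `a` (or `M`) on `‖A x κ‖`.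

WHAT THIS FILE PROVES (kernel, no `sorry`, standard axioms), for `L ≥ 1`, any `d`:
* `dbavg_eq_dbar`, `bavg_eq_conj_dbavg` — (89) is the instance `σ = id`, `w = vframe` of the abstract recipe
  `B7Transfer.dbar`, and (92)/(97) at `k = 1`: `V̄₁(c) = v(c₋) V̿₁(c) v(c₊)⁻¹`.
* `frame_cancellation` — `−F̂(c₋) + T_c + F̂(c₊) = L·(Q₀A)_c` (the mechanism above; `T_c = B7Prop1Explicit.Tside`).
* `frame_estimate` — (111)/(112) at `V₀ = 1`, quantitatively: in the region where `V_b = e^{A_b}`, `|A_b| ≤ a`, with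
  `dL·a ≤ θ ≤ 1/64`: `|F(y)| ≤ 4θ`, `|F(y) − F̂(y)| ≤ 17θ²`, `|F̂(y)| ≤ θ`, `|v(y) − 1| ≤ 8θ`, `|v(y) − 1 − F̂(y)| ≤ 33θ²`,
  the same for `v(y)⁻¹` with `−F̂(y)`.
* `dbavg_estimate` — (120)–(123) at `V₀ = 1`: with `(2d+2)L·a ≤ θ ≤ 1/64`,
  `|V̿₁(c) − 1 − L(Q₀A)_c| ≤ 214θ²`, `|V̿₁(c) − 1| ≤ 5θ`, `|log V̿₁(c) − L(Q₀A)_c| ≤ 314θ²`.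
* `prop3_flat` — THE PRINTED SHAPE: for `a ≤ c₃(d, L) := 1/(128(d+1)L)`,
  `‖log V̿₁(c) − L·(Q₀A)_c‖ ≤ C₁(d)·L²·a²` with `C₁(d) = 1256(d+1)²` ((122)–(123) at `V₀ = 1`: "`C₁` depends on `d` and
  `c₃` depends on `d` and `L`"), and `‖(Q₀A)_c‖ ≤ a` ((125)–(126) at `V₀ = 1`); `norm_linQ_le`, `norm_Q0form_le`.
* `hasDerivAt_mlog_dbavg_ray` — (122) READ AS PRINT DEFINES IT ("its Taylor expansion begins with a first-order
  polynomial. Let us denote it by L(Q(V₀)A)_c"): for every bounded bond field `A`, the function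
  `t ↦ log V̿₁(c)[V₁ = e^{tA}]` of a real variable has derivative `L·(Q₀A)_c` at `t = 0` (and value `0`, `mlog_dbavg_zero`)
  — the first-order Taylor term of `Q(1, ·, c)` along every ray is the main term (125).
* §5 (v1.1) `prop3_flat_analyticAt` — Prop. 3's "`Q(V₀, A)` … is an analytic function of `A`" AT `V₀ = 1`: for a bond
  field `A = B(t)` depending on a parameter `t` of a complex normed space `E` with every bond variable `t ↦ B(t)_b`
  analytic at `t₀`, and `|B(t₀)_b| ≤ a ≤ c₃(d, L)` on the region, `t ↦ log V̿₁(c)[e^{B(t)}]` is `AnalyticAt ℂ` at `t₀`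
  (composition: bondwise `exp` — Mathlib `NormedSpace.exp_analytic`; finite products along contours —
  `analyticAt_hol_expCfg`; the series log (21) on `|X − 1| < 1` — the tree's `ExpMeanLog.analyticAt_mlog` of
  `BlockAveragingExpMeanLog` (imported for this purpose from v1.1 on) — at the inner contours (`|W − 1| ≤ 2θ`, `side_estimate` /
  `walk_linear`) and at `V̿₁(c)` (`|V̿₁(c) − 1| ≤ 5θ`, `dbavg_estimate`): `logDomain_of_le_c3`; finite sums, real scalar
  multiples); `prop3_flat_analyticOnNhd` — hence analytic on a neighbourhood of every point of the open set
  `{t : |B(t)_b| < c₃(d, L) on the region}` = the domain (109) with `α₁ = c₃` (cell shorthand `𝔤^c(c₃)`) read through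
  the parametrisation;
  `prop3_flat_analyticOnNhd_linCfg` — the coordinate form for the finite complex-linear families `B(t) = Σ_{i<m} tᵢAᵢ`,
  `t ∈ ℂ^m` (joint analyticity in `m` complex variables); `prop3_flat_analyticAt_ray` — complex rays `B(t) = tA`,
  `M|t| ≤ c₃`; `hasDerivAt_mlog_dbavg_complexRay` — the complex derivative at `t = 0` along a ray is `L·(Q₀A)_c`: the
  Taylor expansion of the analytic function `t ↦ Q(1, tA, c)` begins with `t·L·(Q₀A)_c`, (122) with (125);
  (v1.2) `prop3_flat_analyticOnNhd_ins` — THE PRINTED LETTER at `V₀ = 1`: for every finite set `S` of bonds, the function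
  `𝔸^S → 𝔸`, `(A_b)_{b∈S} ↦ (1/i) log V̿₁(c)[e^{A} on S, 1 off S]` (`insCfg`), is analytic on a neighbourhood of every point
  of the polydisc `{|A_b| < c₃(d, L), b ∈ S}` (take `S ⊇` the bonds of `B(c₋) ∪ B(c₊)`, the only ones `V̿₁(c)` depends on);
  (v1.3) (122) IN FRÉCHET FORM on `𝔸^S`: `hasFDerivAt_mlog_dbavg_ins` — `A ↦ Q(1, A, c)` is Fréchet-differentiable at
  `A = 0` with derivative the continuous linear form `A ↦ L·(Q₀A)_c`; `prop3_flat_C_ins` — the remainder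
  `C(1, A, c) = Q(1, A, c) − L·(Q₀A)_c` is analytic on the polydisc, `C(1, 0, c) = 0` and `DC(1, ·, c)(0) = 0` ("whose
  Taylor's expansion begins with a second-order polynomial"); supporting `stepA_csmul`/`asum_csmul`/`linQ_csmul`
  (`ℂ`-linearity of (125)), `analyticAt_asum`/`analyticAt_linQ`, `insCfg_smul`/`insCfg_zero`/`norm_insCfg_le`,
  `hasDerivAt_mlog_dbavg_ins_dir`, `hasFDerivAt_linQ_ins`.

ABSOLUTE-RULE LEDGER.  Hypotheses of every theorem: NONE beyond the displayed ones; all objects are the concrete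
`bavg` (42), `vframe` (110)|_{V₀=1}, `dbavg` (89)|_{V₀=1} of the tree.  No `B7.Prop*` placeholder is assumed, nothing of
the manuscript is cited as a fact; `B7.Prop3Printed` is neither used nor claimed.

DIVERGENCES from print (located; cell DIVERGENCE.md D-b07g16.2; (a′) = D-b07g16.3; §5: D-b07g16.4–.5; v1.3.1 re-quotes:
D-b07g17.2).  (a) FLAT BACKGROUND ONLY: `V₀ = 1` (`α₀ = 0`); the
curved case — the axial gauge `R_{0,y}`, the rotations `R̄_{0,c}`, the operators `g(∓i ad_{Y_x})`, `e^{±i ad_Y}` and the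
four correction terms of (124), the threshold `c₃ ≤ c₂` in `α₀` — is NOT treated; consequently the leaf
`B7.Prop3Printed` (all `V₀` with `|V₀(∂p) − 1| < α₀`) is NOT discharged.  (a′) ANALYTICITY (v1.1, §5; cell
DIVERGENCE.md D-b07g16.3) is certified at `V₀ = 1` in the parametrised form: `t ↦ Q(1, B(t), c)` is analytic at `t₀`
whenever the bond variables `B(t)_b` are analytic at `t₀` and `|B(t₀)| ≤ c₃` on the region (`E` any complex normed
parameter space).  Print's "is an analytic function of `A`" (Prop. 3), "an analytic function of the variables `A_b`,
`b ⊂ B(c₋)∪B(c₊)`" (p. 34) — `A` ranging over the finitely many bond variables `A_b ∈ 𝔤^c`, `b ⊂ B(c₋) ∪ B(c₊)`, on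
which `V̿₁(c)` depends (locality pp. 31, 34), with `|A_b| < α₁ ≤ c₃` (109) (cell shorthand `𝔤^c(c₃)`) — is the instance `E = ` that finite
product, `B = ` the insertion map (each coordinate a continuous linear, hence analytic, function): from v1.2 this
instance is spelled out for an ARBITRARY finite bond set `S` (`insCfg`, `prop3_flat_analyticOnNhd_ins`: analytic on the
polydisc `{|A_b| < c₃, b ∈ S}` of `𝔸^S`, the other bond variables frozen at the unit); what is still not made is a
`Set`-level statement "in `A`" over the (non-normable) type `Site d → Fin d → 𝔸` of ALL bond fields at once, and the
dependency set `B(c₋) ∪ B(c₊)` is not singled out as a named `Finset` (any `S` is allowed); the v1 remark in the docstring of `hasDerivAt_mlog_dbavg_ray` ("analyticity …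
is not formalised here") refers to §4 and is superseded by §5.  Joint analyticity in `(V₀, A)` and the curved case are
not treated.  (b) LOGARITHM = the series (21) (`MatrixLog.mlog`,
`|X − 1| < 1`), as in `B7Prop1Explicit` (D-b07g13.1); all its arguments are certified to lie within `5θ ≤ 5/64` of `1`.
(c) SETTING: `ℤ^d` (no torus), a complete normed `ℂ`-algebra `𝔸` (for `M_N(ℂ)`), `A_b ∈ 𝔸` arbitrary small (print:
`A_b ∈ 𝔤^c`, `V_{1,b} = e^{iA_b}`; the `i` is absorbed), norms `≤ a` (print `< α₁`); the region of control is an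
`l¹`-ball of radius `R ≥ |c₋ − y|₁ + (2d+2)L` about an arbitrary `y` (it contains `B(c₋) ∪ B(c₊)` and all contours
used — the printed locality, p. 31 "these averages have the same locality properties as the averages `Ū^k`, namely
`(Ū^k)_c, c ⊂ Ω^{(k)}`, depends on the variables `U_b` for `b ⊂ B^k(c₋)∪B^k(c₊)`" and p. 34 "the definition of
`(U̿₁^k)_c` … involves only the gauge fields `U_{1,b}, U_{0,b}` at bonds `b ⊂ B^k(c₋)∪B^k(c₊)`", is respected but not
recorded as a `Set`-level statement).  (d) CONSTANTS: `C₁ = 1256(d+1)²`, `c₃ = 1/(128(d+1)L)` are admissible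
witnesses, not optimal (print: unspecified; G-B7-02 "C₁ never tracked").  (e) (122) is rendered as the inequality
`‖Q − L·(Q₀A)_c‖ ≤ C₁L²a²` plus the derivative statements (real / complex rays, v1/v1.1; the Fréchet derivative at `0` on
`𝔸^S`, v1.3); the remainder `C(1, A, c)` appears as the explicit difference `Q(1, A, c) − L·(Q₀A)_c` (v1.3
`prop3_flat_C_ins`: analytic, `C(0) = 0`, `DC(0) = 0` on `𝔸^S`), not as a separately named function, and its
second-order Taylor polynomial is not exhibited (only the bound (123)).

FINDINGS (cell GAPS.md C-b07g16-2).  At `V₀ = 1` the printed (120)–(125) are correct with every `O(·)` finite and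
`d`-dependent only, exactly as Prop. 3 claims for `C₁`; the cancellation of the tree-contour terms between `Ṽ₁` and the
two block frames — the reason the main term (125) contains only straight segments, as the averaging operation `Q` of
[2] = B5 (1.11) — is kernel-checked (`frame_cancellation`).  No gap located.  VALUE = first kernel-certified piece of
Prop. 3 for the paper's own objects (the junction B7 (42)/(89) ↔ B5 `Q`); NOT summit progress (the curved-background
linear form (124), the curved-background analyticity, and papers B8–B13 remain).

v1.1 (gen 16, same seat): §5 ANALYTICITY appended (`val_bavg`, `val_dbavg`, `analyticAt_hol_expCfg`, `analyticAt_Wcx_expCfg`, `analyticAt_Xavg_expCfg`, `analyticAt_bavg_expCfg`,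
`analyticAt_Favg_expCfg`, `analyticAt_dbavg_expCfg`, `analyticAt_mlog_dbavg_expCfg`, `logDomain_of_le_c3`,
`prop3_flat_analyticAt`, `c3_nonneg`, `prop3_flat_analyticOnNhd`, `linCfg`, `analyticAt_linCfg`,
`prop3_flat_analyticOnNhd_linCfg`, `prop3_flat_analyticAt_ray`, `hasDerivAt_mlog_dbavg_complexRay`); module docstring:
title, contents bullet §5, companions, DIVERGENCES (a) split into (a)/(a′); every v1 declaration (p186437)
byte-identical; ONE import added (`BlockAveragingExpMeanLog`, for `ExpMeanLog.analyticAt_mlog` — gate dedup rule: reuse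
the landed statement instead of restating it).
v1.2 (gen 16, same seat): §5 tail appended (`c3_pos`, `insCfg`, `analyticAt_insCfg`, `norm_insCfg_lt`,
`prop3_flat_analyticOnNhd_ins` — the printed letter "analytic function of `A`" over any finite set of bond variables);
module docstring: contents bullet, DIVERGENCES (a′) updated; every v1.1 declaration (p186604) byte-identical; imports
unchanged w.r.t. v1.1.
v1.3 (gen 16, same seat): §5 second tail appended — (122) in Fréchet form on `𝔸^S` (`stepA_csmul`, `asum_csmul`,
`linQ_csmul`, `analyticAt_asum`, `analyticAt_linQ`, `insCfg_smul`, `insCfg_zero`, `norm_insCfg_le`,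
`hasDerivAt_mlog_dbavg_ins_dir`, `hasFDerivAt_mlog_dbavg_ins`, `hasFDerivAt_linQ_ins`, `prop3_flat_C_ins`); module
docstring: contents bullet, DIVERGENCES (e) updated; every v1.2 declaration (p186632) byte-identical; imports unchanged.
v1.3.1 (gen 17): DOCSTRING-ONLY revision folding the cross-read findings on v1–v1.3 (XREAD C-pv26g9-7 F1/A1, C-pv14-88
Q1/A1, C-pv05g13-3 Q1′/I2, C-pv05g13-5): the record pointer D-b07g16.1 → D-b07g16.2 (F1); the `vframe`/(62) inversion
note in the DICTIONARY (A1); `𝔤^c(c₃)` declared as CELL SHORTHAND for (109) with `α₁ = c₃` and Prop. 3 / p. 34 re-quoted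
verbatim wherever the v1.1–v1.3 docstrings had dressed the shorthand as a quotation (Q1/Q1′; docstrings of
`prop3_flat_analyticAt`, `prop3_flat_analyticOnNhd`, `insCfg`, `prop3_flat_analyticOnNhd_ins`); the p. 31 locality
sentence quoted verbatim (print: single-bar `(Ū^k)_c` with "the same locality properties" for the double-bar averages)
and the p. 34 sentences around (109) added to THE PRINTED TEXT (I2); every declaration byte-identical to v1.3 (p187645);
imports unchanged.
v1.3.2 (gen 18): DOCSTRING-ONLY — the DIVERGENCE pointer of this header completed per XREAD #167 (REFEREE5, DOCFIX LOW
167.1): the §5 rows D-b07g16.4–.5 and the v1.3.1 re-quotation row D-b07g17.2 are now named; every declaration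
byte-identical to v1.3.1 (p188373); imports unchanged.
-/

noncomputable section

open scoped BigOperators
open NormedSpace Finset

namespace Literature.MathematicalPhysics.QuantumFieldTheory.Balaban1983to89.B7Prop3Flat

open B7Prop1Explicit MatrixLog

-- `Site` alone would resolve to the torus sites of `Setup.lean`; re-export the `ℤ^d` sites of `B7Prop1Explicit`.
export B7Prop1Explicit (Site)

variable {d : ℕ}

/-! ## §1 The objects of Sect. C at the flat background `V₀ = 1` -/

section Defs

variable {𝔸 : Type*} [NormedRing 𝔸] [NormedAlgebra ℂ 𝔸] [CompleteSpace 𝔸]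
variable (L : ℕ)

/-- **(110) at `V₀ = 1`, the exponent**: `F(y) := Σ_{x∈B(y)} L^{−d} log V₁(Γ_{y,x})` (`y = q`, `x = q + r`,
`Γ_{y,x}` = `treeWord r` based at `q`; at `V₀ = 1`, `(R_{0,y}V₁)(Γ_{y,x}) = V₁(Γ_{y,x})` by (58)). [cite: Balaban1985Averaging, (110) p.34, (82) p.30, (58) p.27] -/
def Favg (V : Site d → Fin d → 𝔸ˣ) (q : Site d) : 𝔸 :=
  ∑ r : Fin d → Fin L, (((L : ℝ) ^ d)⁻¹) • mlog ((hol V q (treeWord (boxVec L r)) : 𝔸ˣ) : 𝔸)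

/-- **(110)/(82) at `V₀ = 1`**: the block frame `v(y) := \overline{R_{0,y}V₁} = exp F(y)` — the one-step average (78) of the
gauge function `x ↦ V₁(Γ_{y,x})` on the block `B(y)`. [cite: Balaban1985Averaging, (110) p.34, (82) p.30] -/
def vframe (V : Site d → Fin d → 𝔸ˣ) (q : Site d) : 𝔸ˣ := expUnit (Favg L V q)

/-- **(89)/(90)/(120) at `V₀ = 1`, the "double-bar" average**: `V̿₁(c) := v(c₋)⁻¹ · V̄₁(c) · v(c₊)` for the `L`-bond
`c = ⟨q, q + Le_κ⟩` (`V̄₀ = 1`, `R̄_{0,c} = id`, `Ṽ₁ = V̄₁` = the average (42) `bavg`). [cite: Balaban1985Averaging, (89)–(90) p.31, (120) p.35] -/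
def dbavg (V : Site d → Fin d → 𝔸ˣ) : Site d → Fin d → 𝔸ˣ := fun q κ =>
  (vframe L V q)⁻¹ * bavg L V q κ * vframe L V (q + (L : ℤ) • e κ)

/-- **The exponent of (112) at `V₀ = 1`**: `F̂(y) := Σ_{x∈B(y)} L^{−d} A(Γ_{y,x})` (`(R_{0,y}A)(Γ_{y,x}) = A(Γ_{y,x})` at
`V₀ = 1`), the linearisation of `F(y)`. [cite: Balaban1985Averaging, (111)–(112) p.34] -/
def Fhat (A : Site d → Fin d → 𝔸) (q : Site d) : 𝔸 :=
  ∑ r : Fin d → Fin L, (((L : ℝ) ^ d)⁻¹) • asum A q (treeWord (boxVec L r))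

/-- **`L·(Q₀A)_c`** = `Σ_{x∈B(c₋)} L^{−d} A([x, x′])`, `x′ = x + Le_κ` — the linear part (122) of `(1/i) log V̿₁(c)` at `V₀ = 1`
(READING C-adv4-22 of «L(Q(V₀)A)_c»; cf. p. 28 "`(Q₀A)(c) = Σ_{x∈B(c₋)} L^{−d}(R_{0,c₋}A)([x, x(c)])`"). [cite: Balaban1985Averaging, (122) p.36, p.28] -/
def linQ (A : Site d → Fin d → 𝔸) (q : Site d) (κ : Fin d) : 𝔸 :=
  ∑ r : Fin d → Fin L, (((L : ℝ) ^ d)⁻¹) • asum A (q + boxVec L r) (seg κ L)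

/-- **(125) verbatim normalisation**: `(Q₀A)_c = Σ_{x∈B(c₋)} L^{−(d+1)} A([x, x′])` (at `V₀ = 1`, `R_{0,c₋}A = A`) — "it resembles
the definition of the averaging operation `Q` in [2]" (B5 (1.11)). [cite: Balaban1985Averaging, (125) p.36] -/
def Q0form (A : Site d → Fin d → 𝔸) (q : Site d) (κ : Fin d) : 𝔸 :=
  ∑ r : Fin d → Fin L, (((L : ℝ) ^ (d + 1))⁻¹) • asum A (q + boxVec L r) (seg κ L)

omit [CompleteSpace 𝔸] in
/-- `L·(Q₀A)_c = L • (Q₀A)_c`: the two normalisations (122)/(125). [cite: Balaban1985Averaging, (122) + (125) p.36] -/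
theorem linQ_eq_smul_Q0form (hL : 1 ≤ L) (A : Site d → Fin d → 𝔸) (q : Site d) (κ : Fin d) :
    linQ L A q κ = (L : ℝ) • Q0form L A q κ := by
  unfold linQ Q0form
  rw [Finset.smul_sum]
  refine Finset.sum_congr rfl fun r _ => ?_
  rw [smul_smul]
  congr 1
  have hL0 : (L : ℝ) ≠ 0 := by exact_mod_cast (by omega : L ≠ 0)
  rw [pow_succ]
  field_simp

omit [CompleteSpace 𝔸] in
/-- **The mechanism of (125) at `V₀ = 1`**: `−F̂(c₋) + T_c + F̂(c₊) = L·(Q₀A)_c`, `T_c = Σ_x L^{−d} A(Γ_{c,x})` the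
first-order term of `V̄₁(c)` (`B7Prop1Explicit.Tside`): by (14) `A(Γ_{c,x}) = A(Γ_{c₋,x}) + A([x, x′]) − A(Γ_{c₊,x′})`
the tree-contour terms cancel against the frames; an identity of formal sums, no smallness. [cite: Balaban1985Averaging, (120) p.35, (124)–(125) p.36, (14) p.19] -/
theorem frame_cancellation (A : Site d → Fin d → 𝔸) (q : Site d) (κ : Fin d) :
    -Fhat L A q + Tside L A q κ + Fhat L A (q + (L : ℤ) • e κ) = linQ L A q κ := by
  simp only [Fhat, Tside, linQ, asum_gammaWord, smul_add, smul_sub, Finset.sum_add_distrib,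
    Finset.sum_sub_distrib]
  abel

/-- **(92)/(97) at `k = 1`, `V₀ = 1`**: `V̄₁(c) = Ṽ₁(c) = v(c₋) V̿₁(c) v(c₊)⁻¹` ((89) solved for the average). [cite: Balaban1985Averaging, (92) p.31, (97) p.32] -/
theorem bavg_eq_conj_dbavg (V : Site d → Fin d → 𝔸ˣ) (q : Site d) (κ : Fin d) :
    bavg L V q κ = vframe L V q * dbavg L V q κ * (vframe L V (q + (L : ℤ) • e κ))⁻¹ := by
  simp only [dbavg]; group

/-- The concrete `dbavg` is the instance of the ABSTRACT recipe (89) `B7Transfer.dbar` (arbitrary group, arbitrary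
site-function recipe `w`) with bonds `c = (q, κ)`, `c₋ = q`, `c₊ = q + Le_κ`, `σ_c = id` (`R̄_{0,c} = 1` at `V₀ = 1`),
`avg` = (42) and `w` = (110)|_{V₀=1}. [cite: Balaban1985Averaging, (89) p.31] -/
theorem dbavg_eq_dbar (V : Site d → Fin d → 𝔸ˣ) (q : Site d) (κ : Fin d) :
    dbavg L V q κ = B7Transfer.dbar (fun c : Site d × Fin d => c.1) (fun c => c.1 + (L : ℤ) • e c.2)
      (fun _ => MonoidHom.id 𝔸ˣ) (fun Y c => bavg L (Function.curry Y) c.1 c.2)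
      (fun Y y => vframe L (Function.curry Y) y) (Function.uncurry V) (q, κ) := by
  simp [B7Transfer.dbar_apply, dbavg, Function.curry_uncurry]

/-- **(109)**: the configuration `V₁ = e^{A}` bondwise (`V_{1,b} = e^{iA_b}`, the `i` absorbed into `A`). [cite: Balaban1985Averaging, (109) p.34] -/
def expCfg (A : Site d → Fin d → 𝔸) : Site d → Fin d → 𝔸ˣ := fun x κ => expUnit (A x κ)

omit [CompleteSpace 𝔸] in
/-- `stepA_smul`: the abelian path functional is linear in the field — bookkeeping. [folklore] -/
theorem stepA_smul (t : ℝ) (A : Site d → Fin d → 𝔸) (x : Site d) (l : Letter d) :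
    stepA (t • A) x l = t • stepA A x l := by
  obtain ⟨μ, b⟩ := l
  cases b
  · simp [stepA_false, smul_neg]
  · simp [stepA_true]

omit [CompleteSpace 𝔸] in
/-- `A ↦ A(Γ)` is linear: `(tA)(Γ) = t·A(Γ)` — bookkeeping. [folklore] -/
theorem asum_smul (t : ℝ) (A : Site d → Fin d → 𝔸) :
    ∀ (x : Site d) (w : List (Letter d)), asum (t • A) x w = t • asum A x w
  | x, [] => by simp
  | x, l :: w => by rw [asum_cons, asum_cons, asum_smul t A _ w, stepA_smul, smul_add]

omit [CompleteSpace 𝔸] in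
/-- `L·(Q₀(tA))_c = t·L·(Q₀A)_c`: the main term (125) is a LINEAR form in `A`. [cite: Balaban1985Averaging, (125) p.36] -/
theorem linQ_smul (t : ℝ) (A : Site d → Fin d → 𝔸) (q : Site d) (κ : Fin d) :
    linQ L (t • A) q κ = t • linQ L A q κ := by
  simp only [linQ, asum_smul, Finset.smul_sum, smul_comm t]

end Defs

/-! ## §3 Second-order estimates in the region `V₁ = e^{A}`, `|A_b| ≤ a` -/

section Estimates

variable {𝔸 : Type*} [NormedRing 𝔸] [NormedAlgebra ℂ 𝔸] [CompleteSpace 𝔸]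

omit [CompleteSpace 𝔸] in
/-- **(125)–(126) at `V₀ = 1`, un-normalised**: `|L·(Q₀A)_c| ≤ L·a` if `|A_b| ≤ a` on the bonds of the straight segments
`[x, x′]`, `x ∈ B(c₋)` (all within `l¹`-distance `|c₋ − y|₁ + dL + L` of `y`): the weights `L^{−d}` are a probability
vector and each segment has `L` bonds. [cite: Balaban1985Averaging, (125)–(126) p.36] -/
theorem norm_linQ_le (A : Site d → Fin d → 𝔸) (y : Site d) (R : ℕ) {a : ℝ} (ha : 0 ≤ a)
    (hA : ∀ x κ, l1 (x - y) ≤ R → ‖A x κ‖ ≤ a) (L : ℕ) (hL : 1 ≤ L) (q : Site d) (κ : Fin d)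
    (hR : l1 (q - y) + (d * L + L) ≤ R) :
    ‖linQ L A q κ‖ ≤ L * a := by
  refine norm_avg_le L hL _ fun r => ?_
  have hfit : l1 (q + boxVec L r - y) + (seg κ (L : ℤ)).length ≤ R := by
    rw [length_seg, Int.natAbs_natCast]
    have h1 := l1_add_le (q - y) (boxVec L r)
    have h2 := l1_boxVec_le L r
    rw [show q - y + boxVec L r = q + boxVec L r - y by abel] at h1
    omega
  have h := norm_asum_le A y R ha hA (seg κ (L : ℤ)) (q + boxVec L r) hfit
  rwa [length_seg, Int.natAbs_natCast] at h

omit [CompleteSpace 𝔸] in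
/-- **(125)–(126) at `V₀ = 1`, verbatim**: "`|(Q₀A)_c| ≤ |A|`" — `‖(Q₀A)_c‖ ≤ a` if `|A_b| ≤ a` on the relevant bonds. [cite: Balaban1985Averaging, (126) p.36] -/
theorem norm_Q0form_le (A : Site d → Fin d → 𝔸) (y : Site d) (R : ℕ) {a : ℝ} (ha : 0 ≤ a)
    (hA : ∀ x κ, l1 (x - y) ≤ R → ‖A x κ‖ ≤ a) (L : ℕ) (hL : 1 ≤ L) (q : Site d) (κ : Fin d)
    (hR : l1 (q - y) + (d * L + L) ≤ R) :
    ‖Q0form L A q κ‖ ≤ a := by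
  have hL0 : (0 : ℝ) < L := by exact_mod_cast (by omega : 0 < L)
  have h := norm_linQ_le A y R ha hA L hL q κ hR
  rw [linQ_eq_smul_Q0form L hL, norm_smul, Real.norm_of_nonneg hL0.le] at h
  exact le_of_mul_le_mul_left h hL0

/-- **(111)–(112) at `V₀ = 1`, quantitatively.**  In the region (an `l¹`-ball of radius `R` about `y` containing `B(q)`)
where `V_b = e^{A_b}`, `|A_b| ≤ a`, and with `dL·a ≤ θ ≤ 1/64` (`dL ≥ |Γ_{y,x}|`): `|F(q)| ≤ 4θ`,
`|F(q) − F̂(q)| ≤ 17θ²` ((111) averaged: `16θ²` from `log W − (W − 1)` via (26), `θ²` from `V₁(Γ) − 1 − A(Γ)`),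
`|F̂(q)| ≤ θ`; and for the frame `v(q) = e^{F(q)}` ((112)): `|v(q) − 1| ≤ 8θ`, `|v(q) − 1 − F̂(q)| ≤ 33θ²`, the same for
`v(q)⁻¹ = e^{−F(q)}` with `−F̂(q)`.  Print: "`\overline{R_{0,y}V₁} = exp[i Σ L^{−d}(R_{0,y}A)(Γ_{y,x}) + O(L²α₁²)]`" —
here `O(L²α₁²) = 17θ²`, `θ = (2d+2)L·a` downstream. [cite: Balaban1985Averaging, (111)–(112) p.34] -/
theorem frame_estimate (V : Site d → Fin d → 𝔸ˣ) (A : Site d → Fin d → 𝔸) (y : Site d) (R : ℕ) {a θ : ℝ}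
    (ha : 0 ≤ a) (hVA : ∀ x κ, l1 (x - y) ≤ R → ((V x κ : 𝔸ˣ) : 𝔸) = exp (A x κ) ∧ ‖A x κ‖ ≤ a)
    (L : ℕ) (hL : 1 ≤ L) (q : Site d) (hR : l1 (q - y) + d * L ≤ R)
    (hθ : ((d * L : ℕ) : ℝ) * a ≤ θ) (hθ0 : 0 ≤ θ) (hθ1 : θ ≤ 1 / 64) :
    ‖Favg L V q‖ ≤ 4 * θ ∧ ‖Favg L V q - Fhat L A q‖ ≤ 17 * θ ^ 2 ∧ ‖Fhat L A q‖ ≤ θ ∧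
    ‖((vframe L V q : 𝔸ˣ) : 𝔸) - 1‖ ≤ 8 * θ ∧
    ‖((vframe L V q : 𝔸ˣ) : 𝔸) - 1 - Fhat L A q‖ ≤ 33 * θ ^ 2 ∧
    ‖(((vframe L V q)⁻¹ : 𝔸ˣ) : 𝔸) - 1‖ ≤ 8 * θ ∧
    ‖(((vframe L V q)⁻¹ : 𝔸ˣ) : 𝔸) - 1 - (-Fhat L A q)‖ ≤ 33 * θ ^ 2 := by
  have hA : ∀ x κ, l1 (x - y) ≤ R → ‖A x κ‖ ≤ a := fun x κ hx => (hVA x κ hx).2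
  have hNa : ∀ n : ℕ, n ≤ d * L → (n : ℝ) * a ≤ θ := fun n hn =>
    (mul_le_mul_of_nonneg_right (by exact_mod_cast hn) ha).trans hθ
  -- (111) at `V₀ = 1`: `(1/i) log V₁(Γ_{y,x}) = A(Γ_{y,x}) + O((|A|(Γ_{y,x}))²)` along each tree contour
  have htree : ∀ r : Fin d → Fin L,
      ‖mlog ((hol V q (treeWord (boxVec L r)) : 𝔸ˣ) : 𝔸)‖ ≤ 4 * θ ∧
      ‖mlog ((hol V q (treeWord (boxVec L r)) : 𝔸ˣ) : 𝔸) - asum A q (treeWord (boxVec L r))‖ ≤ 17 * θ ^ 2 ∧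
      ‖asum A q (treeWord (boxVec L r))‖ ≤ θ := by
    intro r
    have hlen : (treeWord (boxVec L r)).length ≤ d * L := by
      rw [length_treeWord]; exact l1_boxVec_le L r
    obtain ⟨h1, h2⟩ := walk_linear V A y R ha hVA (treeWord (boxVec L r)) q (by omega)
    have hna := hNa _ hlen
    have hW : ‖((hol V q (treeWord (boxVec L r)) : 𝔸ˣ) : 𝔸) - 1‖ ≤ 2 * θ :=
      h1.trans (exp_sub_one_le_of_le hna hθ0 hθ1)
    have hW' : ‖((hol V q (treeWord (boxVec L r)) : 𝔸ˣ) : 𝔸) - 1‖ ≤ 1 / 2 := hW.trans (by linarith)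
    refine ⟨(norm_mlog_le_two_mul hW').trans (by linarith), ?_,
      (norm_asum_le A y R ha hA _ q (by omega)).trans hna⟩
    have h3 := norm_mlog_sub_le hW'
    have h4 : expRem (2 * ‖((hol V q (treeWord (boxVec L r)) : 𝔸ˣ) : 𝔸) - 1‖) ≤ 16 * θ ^ 2 :=
      (expRem_mono (by positivity) (by linarith)).trans (expRem4_le hθ0 hθ1)
    have h5 := expRem_le_sq_of_le (by positivity) hna hθ0 hθ1
    calc _ = ‖(mlog ((hol V q (treeWord (boxVec L r)) : 𝔸ˣ) : 𝔸)
              - (((hol V q (treeWord (boxVec L r)) : 𝔸ˣ) : 𝔸) - 1))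
            + ((((hol V q (treeWord (boxVec L r)) : 𝔸ˣ) : 𝔸) - 1) - asum A q (treeWord (boxVec L r)))‖ := by
            rw [sub_add_sub_cancel]
      _ ≤ _ := norm_add_le _ _
      _ ≤ 16 * θ ^ 2 + θ ^ 2 := add_le_add (h3.trans h4) (h2.trans h5)
      _ = 17 * θ ^ 2 := by ring
  -- the block averages (110)/(112)
  have hFn : ‖Favg L V q‖ ≤ 4 * θ := norm_avg_le L hL _ fun r => (htree r).1
  have hFF : ‖Favg L V q - Fhat L A q‖ ≤ 17 * θ ^ 2 := by
    rw [Favg, Fhat, ← Finset.sum_sub_distrib]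
    simp_rw [← smul_sub]
    exact norm_avg_le L hL _ fun r => (htree r).2.1
  have hFh : ‖Fhat L A q‖ ≤ θ := norm_avg_le L hL _ fun r => (htree r).2.2
  have hFF' : ‖-Favg L V q - -Fhat L A q‖ ≤ 17 * θ ^ 2 := by rwa [← neg_sub', norm_neg]
  -- the exponentials `v(y) = e^{F(y)}`, `v(y)⁻¹ = e^{−F(y)}`
  obtain ⟨hE1, hE2⟩ := norm_exp_sub_one_le_of_norm_le hFn
  obtain ⟨hE1', hE2'⟩ := norm_exp_sub_one_le_of_norm_le (show ‖-Favg L V q‖ ≤ 4 * θ by rwa [norm_neg])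
  have hv : ((vframe L V q : 𝔸ˣ) : 𝔸) = exp (Favg L V q) := rfl
  have hvi : (((vframe L V q)⁻¹ : 𝔸ˣ) : 𝔸) = exp (-Favg L V q) := by
    rw [vframe, val_inv_expUnit, val_expUnit]
  refine ⟨hFn, hFF, hFh, ?_, ?_, ?_, ?_⟩
  · rw [hv]; exact hE1.trans (exp4_sub_one_le hθ0 hθ1)
  · rw [hv]
    calc _ = ‖(exp (Favg L V q) - 1 - Favg L V q) + (Favg L V q - Fhat L A q)‖ := by rw [sub_add_sub_cancel]
      _ ≤ _ := norm_add_le _ _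
      _ ≤ 16 * θ ^ 2 + 17 * θ ^ 2 := add_le_add (hE2.trans (expRem4_le hθ0 hθ1)) hFF
      _ = 33 * θ ^ 2 := by ring
  · rw [hvi]; exact hE1'.trans (exp4_sub_one_le hθ0 hθ1)
  · rw [hvi]
    calc _ = ‖(exp (-Favg L V q) - 1 - -Favg L V q) + (-Favg L V q - -Fhat L A q)‖ := by
            rw [sub_add_sub_cancel]
      _ ≤ _ := norm_add_le _ _
      _ ≤ 16 * θ ^ 2 + 17 * θ ^ 2 := add_le_add (hE2'.trans (expRem4_le hθ0 hθ1)) hFF'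
      _ = 33 * θ ^ 2 := by ring

/-- **(120)–(123) at `V₀ = 1`.**  In the region (radius `R ≥ |c₋ − y|₁ + (2d+2)L` about `y`) where `V_b = e^{A_b}`,
`|A_b| ≤ a`, with `(2d+2)L·a ≤ θ ≤ 1/64`: `|V̿₁(c) − 1 − L·(Q₀A)_c| ≤ 214θ²` ((120): the product
`v(c₋)⁻¹ · V̄₁(c) · v(c₊)` of three factors within `8θ, 2θ, 8θ` of `1` whose first-order terms `−F̂(c₋), T_c, F̂(c₊)`
(remainders `33θ², 50θ², 33θ²` — `frame_estimate`, `B7Prop1Explicit.side_estimate`) add up to `L·(Q₀A)_c` by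
`frame_cancellation`), `|V̿₁(c) − 1| ≤ 5θ` (inside the domain of the series (21)), and (121)–(123):
`|log V̿₁(c) − L·(Q₀A)_c| ≤ 314θ²` (`100θ²` from `log W − (W − 1)`).  Print: "`+ O(L²α₁²)`" in (120),
"`|C(V₀, A, c)| ≤ C₁L²|A|²`" (123). [cite: Balaban1985Averaging, (120) p.35, (121)–(123) p.36] -/
theorem dbavg_estimate (V : Site d → Fin d → 𝔸ˣ) (A : Site d → Fin d → 𝔸) (y : Site d) (R : ℕ) {a θ : ℝ}
    (ha : 0 ≤ a) (hVA : ∀ x κ, l1 (x - y) ≤ R → ((V x κ : 𝔸ˣ) : 𝔸) = exp (A x κ) ∧ ‖A x κ‖ ≤ a)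
    (L : ℕ) (hL : 1 ≤ L) (q : Site d) (κ : Fin d) (hR : l1 (q - y) + (2 * (d * L) + L + L) ≤ R)
    (hθ : ((2 * (d * L) + L + L : ℕ) : ℝ) * a ≤ θ) (hθ0 : 0 ≤ θ) (hθ1 : θ ≤ 1 / 64) :
    ‖((dbavg L V q κ : 𝔸ˣ) : 𝔸) - 1 - linQ L A q κ‖ ≤ 214 * θ ^ 2 ∧
    ‖((dbavg L V q κ : 𝔸ˣ) : 𝔸) - 1‖ ≤ 5 * θ ∧
    ‖mlog ((dbavg L V q κ : 𝔸ˣ) : 𝔸) - linQ L A q κ‖ ≤ 314 * θ ^ 2 := by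
  have hA : ∀ x κ, l1 (x - y) ≤ R → ‖A x κ‖ ≤ a := fun x κ hx => (hVA x κ hx).2
  have hθd : ((d * L : ℕ) : ℝ) * a ≤ θ :=
    (mul_le_mul_of_nonneg_right (by exact_mod_cast (by omega : d * L ≤ 2 * (d * L) + L + L)) ha).trans hθ
  -- the three factors
  obtain ⟨-, -, -, -, -, h1φ, h1δ⟩ := frame_estimate V A y R ha hVA L hL q (by omega) hθd hθ0 hθ1
  obtain ⟨h2φ, h2δ, -, -, -⟩ := side_estimate V A y R ha hVA L hL q κ hR hθ hθ0 hθ1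
  have hR' : l1 (q + (L : ℤ) • e κ - y) + d * L ≤ R := by
    have := l1_add_le (q - y) ((L : ℤ) • e κ)
    rw [l1_zsmul_e, Int.natAbs_natCast, show q - y + (L : ℤ) • e κ = q + (L : ℤ) • e κ - y by abel] at this
    omega
  obtain ⟨-, -, -, h3φ, h3δ, -, -⟩ := frame_estimate V A y R ha hVA L hL (q + (L : ℤ) • e κ) hR' hθd hθ0 hθ1
  set F₁ : 𝔸 := (((vframe L V q)⁻¹ : 𝔸ˣ) : 𝔸) with hF₁
  set F₂ : 𝔸 := ((bavg L V q κ : 𝔸ˣ) : 𝔸) with hF₂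
  set F₃ : 𝔸 := ((vframe L V (q + (L : ℤ) • e κ) : 𝔸ˣ) : 𝔸) with hF₃
  set t₁ : 𝔸 := -Fhat L A q with ht₁
  set t₂ : 𝔸 := Tside L A q κ with ht₂
  set t₃ : 𝔸 := Fhat L A (q + (L : ℤ) • e κ) with ht₃
  have hD : ((dbavg L V q κ : 𝔸ˣ) : 𝔸) = F₁ * F₂ * F₃ := by
    simp only [dbavg, Units.val_mul, hF₁, hF₂, hF₃]
  -- two factors
  have g2 : ‖F₁ * F₂ - 1‖ ≤ 10 * θ + 16 * θ ^ 2 := by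
    refine (B7Prop6Bound.mul_sub_one_norm_le _ _).trans ?_
    nlinarith [norm_nonneg (F₁ - 1), norm_nonneg (F₂ - 1), mul_le_mul h1φ h2φ (norm_nonneg _) (by positivity)]
  have e2 : ‖F₁ * F₂ - 1 - (t₁ + t₂)‖ ≤ 99 * θ ^ 2 := by
    refine (norm_mul_sub_one_sub_le _ _ _ _).trans ?_
    nlinarith [mul_le_mul h1φ h2φ (norm_nonneg _) (by positivity)]
  -- three factors
  have e3 : ‖F₁ * F₂ * F₃ - 1 - (t₁ + t₂ + t₃)‖ ≤ 214 * θ ^ 2 := by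
    refine (norm_mul_sub_one_sub_le _ _ _ _).trans ?_
    have h10 : (0 : ℝ) ≤ 10 * θ + 16 * θ ^ 2 := by positivity
    have := mul_le_mul g2 h3φ (norm_nonneg _) h10
    nlinarith
  have hlin : t₁ + t₂ + t₃ = linQ L A q κ := frame_cancellation L A q κ
  rw [hlin] at e3
  have hQ : ‖linQ L A q κ‖ ≤ θ := by
    refine (norm_linQ_le A y R ha hA L hL q κ (by omega)).trans ?_
    exact (mul_le_mul_of_nonneg_right (by exact_mod_cast (by omega : L ≤ 2 * (d * L) + L + L)) ha).trans hθ
  have hD1 : ‖F₁ * F₂ * F₃ - 1‖ ≤ 5 * θ := by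
    calc ‖F₁ * F₂ * F₃ - 1‖ = ‖(F₁ * F₂ * F₃ - 1 - linQ L A q κ) + linQ L A q κ‖ := by rw [sub_add_cancel]
      _ ≤ 214 * θ ^ 2 + θ := (norm_add_le _ _).trans (add_le_add e3 hQ)
      _ ≤ 5 * θ := by nlinarith
  refine ⟨by rw [hD]; exact e3, by rw [hD]; exact hD1, ?_⟩
  rw [hD]
  have hD1' : ‖F₁ * F₂ * F₃ - 1‖ ≤ 1 / 2 := hD1.trans (by linarith)
  have hlog := norm_mlog_sub_le hD1'
  have hrem : expRem (2 * ‖F₁ * F₂ * F₃ - 1‖) ≤ 100 * θ ^ 2 := by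
    refine (expRem_mono (by positivity) (show 2 * ‖F₁ * F₂ * F₃ - 1‖ ≤ 10 * θ by linarith)).trans ?_
    have := expRem_le_sq (by positivity : (0 : ℝ) ≤ 10 * θ) (by linarith)
    nlinarith
  calc _ = ‖(mlog (F₁ * F₂ * F₃) - (F₁ * F₂ * F₃ - 1)) + (F₁ * F₂ * F₃ - 1 - linQ L A q κ)‖ := by
          rw [sub_add_sub_cancel]
    _ ≤ _ := norm_add_le _ _
    _ ≤ 100 * θ ^ 2 + 214 * θ ^ 2 := add_le_add (hlog.trans hrem) e3
    _ = 314 * θ ^ 2 := by ring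


/-! ## §4 Prop. 3 at `V₀ = 1` in the printed shape (122)–(123), (125)–(126), and the first-order Taylor term -/

/-- The witness for the printed `C₁` of (123) at `V₀ = 1`: `C₁(d) = 314·(2(d+1))² = 1256(d+1)²` ("The constant `C₁` depends
on `d`"). [cite: Balaban1985Averaging, Prop. 3 p.36] -/
def C1 (d : ℕ) : ℝ := 1256 * ((d : ℝ) + 1) ^ 2

/-- The witness for the printed threshold `c₃` of Prop. 3 at `V₀ = 1` (a condition on `α₁` only, `α₀ = 0`):
`c₃(d, L) = 1/(128(d+1)L)`, i.e. `(2d+2)L·a ≤ 1/64` ("`c₃` depends on `d` and `L`"). [cite: Balaban1985Averaging, Prop. 3 p.36] -/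
def c3 (d L : ℕ) : ℝ := 1 / (128 * ((d : ℝ) + 1) * L)

/-- **Proposition 3 of B7 at the flat background `V₀ = 1`, printed shape (122)–(123) + (125)–(126), PROVED for the
concrete objects (42)/(110)/(89) on `ℤ^d`**: if `V_b = e^{A_b}` with `|A_b| ≤ a ≤ c₃(d, L) = 1/(128(d+1)L)` on the bonds
within `l¹`-distance `|c₋ − y|₁ + (2d+2)L` of some `y` (this covers `B(c₋) ∪ B(c₊)` and every contour involved), then
`‖(1/i)·log V̿₁(c) − L·(Q₀A)_c‖ ≤ C₁(d)·L²·a²` with `C₁(d) = 1256(d+1)²` — "(122) `Q(V₀, A, c) = L(Q(V₀)A)_c + C(V₀, A, c)`",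
"(123) `|C(V₀, A, c)| ≤ C₁L²|A|²`", with `(Q(V₀)A)_c = (Q₀A)_c` (125) at `V₀ = 1` — and "`|(Q₀A)_c| ≤ |A|`" (126).
The curved background and analyticity are NOT treated (header, DIVERGENCES (a)). [cite: Balaban1985Averaging, Prop. 3 (122)–(126) p.36] -/
theorem prop3_flat (V : Site d → Fin d → 𝔸ˣ) (A : Site d → Fin d → 𝔸) (y : Site d) (R : ℕ) {a : ℝ}
    (ha : 0 ≤ a) (hVA : ∀ x κ, l1 (x - y) ≤ R → ((V x κ : 𝔸ˣ) : 𝔸) = exp (A x κ) ∧ ‖A x κ‖ ≤ a)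
    (L : ℕ) (hL : 1 ≤ L) (q : Site d) (κ : Fin d) (hR : l1 (q - y) + (2 * (d * L) + L + L) ≤ R)
    (hac : a ≤ c3 d L) :
    ‖mlog ((dbavg L V q κ : 𝔸ˣ) : 𝔸) - (L : ℝ) • Q0form L A q κ‖ ≤ C1 d * (L : ℝ) ^ 2 * a ^ 2 ∧
      ‖Q0form L A q κ‖ ≤ a := by
  have hA : ∀ x κ, l1 (x - y) ≤ R → ‖A x κ‖ ≤ a := fun x κ hx => (hVA x κ hx).2
  have hL1 : (1 : ℝ) ≤ L := by exact_mod_cast hL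
  have hcast : ((2 * (d * L) + L + L : ℕ) : ℝ) = 2 * ((d : ℝ) + 1) * L := by push_cast; ring
  set θ : ℝ := ((2 * (d * L) + L + L : ℕ) : ℝ) * a with hθdef
  have hθ0 : 0 ≤ θ := by positivity
  have hθ1 : θ ≤ 1 / 64 := by
    rw [hθdef, hcast]
    have hpos : (0 : ℝ) < 128 * ((d : ℝ) + 1) * L := by positivity
    have h1 : a * (128 * ((d : ℝ) + 1) * L) ≤ 1 := by
      have := mul_le_mul_of_nonneg_right hac hpos.le
      rwa [c3, one_div, inv_mul_cancel₀ hpos.ne'] at this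
    nlinarith
  obtain ⟨-, -, h⟩ := dbavg_estimate V A y R ha hVA L hL q κ hR le_rfl hθ0 hθ1
  rw [linQ_eq_smul_Q0form L hL] at h
  refine ⟨h.trans (le_of_eq ?_), norm_Q0form_le A y R ha hA L hL q κ (by omega)⟩
  rw [hcast, C1]; ring

/-- (122)–(123) at `V₀ = 1` ALONG A RAY: for a bond field with `|A_b| ≤ M` everywhere and `V₁ = e^{tA}`,
`‖log V̿₁(c) − t·L·(Q₀A)_c‖ ≤ 314((2d+2)L·M)²·t²` whenever `(2d+2)L·M·|t| ≤ 1/64`. [cite: Balaban1985Averaging, (122)–(123) p.36] -/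
theorem mlog_dbavg_sub_linQ_le_of_bound (A : Site d → Fin d → 𝔸) {M : ℝ} (hM0 : 0 ≤ M) (hM : ∀ x κ, ‖A x κ‖ ≤ M)
    (L : ℕ) (hL : 1 ≤ L) (q : Site d) (κ : Fin d) (t : ℝ)
    (ht : ((2 * (d * L) + L + L : ℕ) : ℝ) * (M * |t|) ≤ 1 / 64) :
    ‖mlog ((dbavg L (expCfg (t • A)) q κ : 𝔸ˣ) : 𝔸) - t • linQ L A q κ‖
      ≤ 314 * (((2 * (d * L) + L + L : ℕ) : ℝ) * M) ^ 2 * t ^ 2 := by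
  have hVA : ∀ x κ', l1 (x - q) ≤ 2 * (d * L) + L + L →
      (((expCfg (t • A)) x κ' : 𝔸ˣ) : 𝔸) = exp ((t • A) x κ') ∧ ‖(t • A) x κ'‖ ≤ M * |t| := by
    intro x κ' _
    refine ⟨rfl, ?_⟩
    rw [Pi.smul_apply, Pi.smul_apply, norm_smul, Real.norm_eq_abs, mul_comm]
    exact mul_le_mul_of_nonneg_right (hM x κ') (abs_nonneg t)
  obtain ⟨-, -, h⟩ := dbavg_estimate (expCfg (t • A)) (t • A) q (2 * (d * L) + L + L) (by positivity) hVA L hL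
    q κ (by simp [l1]) le_rfl (by positivity) ht
  rw [linQ_smul] at h
  refine h.trans (le_of_eq ?_)
  rw [mul_pow, mul_pow, sq_abs]; ring

/-- At `A = 0` (`V₁ = 1`): `log V̿₁(c) = 0` — the Taylor expansion of `Q(1, ·, c)` has no constant term (p. 36: "its Taylor
expansion begins with a first-order polynomial"). [cite: Balaban1985Averaging, p.36 (after (121))] -/
theorem mlog_dbavg_zero (L : ℕ) (hL : 1 ≤ L) (q : Site d) (κ : Fin d) :
    mlog ((dbavg L (expCfg (0 : Site d → Fin d → 𝔸)) q κ : 𝔸ˣ) : 𝔸) = 0 := by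
  have h := mlog_dbavg_sub_linQ_le_of_bound (0 : Site d → Fin d → 𝔸) le_rfl (fun x κ => by simp) L hL q κ 0
    (by simp)
  simp only [zero_smul, sub_zero, mul_zero, norm_le_zero_iff, sq] at h
  -- `0 • 0 = 0`
  simpa using h

/-- **(122)/(125) as print DEFINES the linear part** ("from (120) it follows that its Taylor expansion begins with a
first-order polynomial. Let us denote it by `L(Q(V₀)A)_c`"), at `V₀ = 1`: for every bounded bond field `A` on `ℤ^d`
(values in the complete normed `ℂ`-algebra `𝔸`), the real function `t ↦ (1/i) log V̿₁(c)[V₁ = e^{tA}]` is differentiable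
at `t = 0` with derivative `L·(Q₀A)_c = Σ_{x∈B(c₋)} L^{−d} A([x, x′])` — the first-order Taylor term along every ray IS
the main term (125); analyticity in `A` (complex `t`, all orders) is not formalised here. [cite: Balaban1985Averaging, (121)–(122) + (125) p.36] -/
theorem hasDerivAt_mlog_dbavg_ray (A : Site d → Fin d → 𝔸) {M : ℝ} (hM0 : 0 ≤ M) (hM : ∀ x κ, ‖A x κ‖ ≤ M)
    (L : ℕ) (hL : 1 ≤ L) (q : Site d) (κ : Fin d) :
    HasDerivAt (fun t : ℝ => mlog ((dbavg L (expCfg (t • A)) q κ : 𝔸ˣ) : 𝔸)) (linQ L A q κ) 0 := by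
  set N : ℝ := ((2 * (d * L) + L + L : ℕ) : ℝ) with hN
  have hN0 : 0 ≤ N := by positivity
  rw [hasDerivAt_iff_isLittleO_nhds_zero]
  have h0 : mlog ((dbavg L (expCfg ((0 : ℝ) • A)) q κ : 𝔸ˣ) : 𝔸) = 0 := by
    rw [zero_smul]; exact mlog_dbavg_zero L hL q κ
  refine (Asymptotics.IsBigO.of_bound (314 * (N * M) ^ 2) ?_).trans_isLittleO
    (Asymptotics.isLittleO_pow_id (one_lt_two))
  rw [Metric.eventually_nhds_iff]
  refine ⟨1 / (64 * (N * M + 1)), by positivity, fun t ht => ?_⟩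
  rw [dist_zero_right, Real.norm_eq_abs] at ht
  have hsmall : N * (M * |t|) ≤ 1 / 64 := by
    have hpos : (0 : ℝ) < 64 * (N * M + 1) := by positivity
    have h1 : |t| * (64 * (N * M + 1)) ≤ 1 := by
      have := mul_le_mul_of_nonneg_right ht.le hpos.le
      rwa [one_div, inv_mul_cancel₀ hpos.ne'] at this
    nlinarith [abs_nonneg t, mul_nonneg hN0 hM0]
  have h := mlog_dbavg_sub_linQ_le_of_bound A hM0 hM L hL q κ t hsmall
  rw [zero_add, h0, sub_zero, norm_pow, Real.norm_eq_abs, sq_abs]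
  exact h

end Estimates

/-! ## §5 Analyticity in `A` at `V₀ = 1` (Prop. 3: "`Q(V₀, A)` … is an analytic function of `A`") -/

section Analytic

variable {𝔸 : Type*} [NormedRing 𝔸] [NormedAlgebra ℂ 𝔸] [CompleteSpace 𝔸]
variable {E : Type*} [NormedAddCommGroup E] [NormedSpace ℂ E]

/-- `val_bavg`: the average (42) as an element of `𝔸`: `V̄(c) = exp(X_c) · V(c)`. [cite: Balaban1985Averaging, (42) p.23] -/
theorem val_bavg (L : ℕ) (V : Site d → Fin d → 𝔸ˣ) (q : Site d) (κ : Fin d) :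
    ((bavg L V q κ : 𝔸ˣ) : 𝔸) = exp (Xavg L V q κ) * hol V q (seg κ L) := by
  simp [bavg]

/-- `val_dbavg`: the double-bar average (89)/(120) at `V₀ = 1` as an element of `𝔸`:
`V̿₁(c) = e^{−F(c₋)} · V̄₁(c) · e^{F(c₊)}`. [cite: Balaban1985Averaging, (89) p.31, (110) p.34, (120) p.35] -/
theorem val_dbavg (L : ℕ) (V : Site d → Fin d → 𝔸ˣ) (q : Site d) (κ : Fin d) :
    ((dbavg L V q κ : 𝔸ˣ) : 𝔸) =
      exp (-Favg L V q) * ((bavg L V q κ : 𝔸ˣ) : 𝔸) * exp (Favg L V (q + (L : ℤ) • e κ)) := by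
  simp [dbavg, vframe]

/-- Parallel transport (9) along a fixed contour is an analytic function of the bond variables: if every `B(t)_b` is
analytic in the parameter `t` (in a complex normed space), so is `t ↦ e^{B(t)}(Γ)` — finite products of `exp(±B(t)_b)`.
[folklore] -/
theorem analyticAt_hol_expCfg (B : E → Site d → Fin d → 𝔸) {t₀ : E}
    (hB : ∀ x κ, AnalyticAt ℂ (fun t => B t x κ) t₀) :
    ∀ (w : List (Letter d)) (x : Site d), AnalyticAt ℂ (fun t => ((hol (expCfg (B t)) x w : 𝔸ˣ) : 𝔸)) t₀
  | [], x => by simpa using analyticAt_const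
  | (μ, true) :: w, x => by
      simp only [hol_cons, Units.val_mul, stepHol_true, expCfg, val_expUnit]
      exact ((exp_analytic _).fun_comp_of_eq (hB x μ) rfl).fun_mul (analyticAt_hol_expCfg B hB w _)
  | (μ, false) :: w, x => by
      simp only [hol_cons, Units.val_mul, stepHol_false, expCfg, val_inv_expUnit, val_expUnit]
      exact ((exp_analytic _).fun_comp_of_eq (hB _ μ).neg rfl).fun_mul (analyticAt_hol_expCfg B hB w _)

/-- … in particular for the closed contours `Γ_{c,x} ∪ (−Γ_c)` of (42). [folklore] -/
theorem analyticAt_Wcx_expCfg (B : E → Site d → Fin d → 𝔸) {t₀ : E}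
    (hB : ∀ x κ, AnalyticAt ℂ (fun t => B t x κ) t₀) (L : ℕ) (q : Site d) (κ : Fin d) (r : Site d) :
    AnalyticAt ℂ (fun t => ((Wcx L (expCfg (B t)) q κ r : 𝔸ˣ) : 𝔸)) t₀ := by
  simp only [Wcx_eq_hol_loop]
  exact analyticAt_hol_expCfg B hB _ q

/-- The exponent `X_c` of (42) is analytic in the bond variables wherever every `V(Γ_{c,x})V(c)⁻¹` lies in the domain
`|W − 1| < 1` of the series logarithm (21) (the series log is analytic there — the tree's `ExpMeanLog.analyticAt_mlog` — and finite
sums / scalar multiples preserve analyticity). [folklore] -/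
theorem analyticAt_Xavg_expCfg (B : E → Site d → Fin d → 𝔸) {t₀ : E}
    (hB : ∀ x κ, AnalyticAt ℂ (fun t => B t x κ) t₀) (L : ℕ) (q : Site d) (κ : Fin d)
    (hW : ∀ r : Fin d → Fin L, ‖((Wcx L (expCfg (B t₀)) q κ (boxVec L r) : 𝔸ˣ) : 𝔸) - 1‖ < 1) :
    AnalyticAt ℂ (fun t => Xavg L (expCfg (B t)) q κ) t₀ := by
  unfold Xavg
  exact Finset.analyticAt_fun_sum _ fun r _ =>
    ((ExpMeanLog.analyticAt_mlog (hW r)).fun_comp_of_eq (analyticAt_Wcx_expCfg B hB L q κ (boxVec L r))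
      rfl).fun_const_smul

/-- The one-step average (42) `V̄(c) = exp(X_c)·V(c)` is analytic in the bond variables (same domain condition;
composition of `analyticAt_Xavg_expCfg` with Mathlib's `NormedSpace.exp_analytic` and `analyticAt_hol_expCfg`).
[cite: Balaban1985Averaging, (42) p.23] -/
theorem analyticAt_bavg_expCfg (B : E → Site d → Fin d → 𝔸) {t₀ : E}
    (hB : ∀ x κ, AnalyticAt ℂ (fun t => B t x κ) t₀) (L : ℕ) (q : Site d) (κ : Fin d)
    (hW : ∀ r : Fin d → Fin L, ‖((Wcx L (expCfg (B t₀)) q κ (boxVec L r) : 𝔸ˣ) : 𝔸) - 1‖ < 1) :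
    AnalyticAt ℂ (fun t => ((bavg L (expCfg (B t)) q κ : 𝔸ˣ) : 𝔸)) t₀ := by
  simp only [val_bavg]
  exact ((exp_analytic _).fun_comp_of_eq (analyticAt_Xavg_expCfg B hB L q κ hW) rfl).fun_mul
    (analyticAt_hol_expCfg B hB _ q)

/-- The frame exponent `F(y)` of (110) at `V₀ = 1` is analytic in the bond variables wherever every `V₁(Γ_{y,x})` lies in
the domain `|W − 1| < 1` of the series logarithm (21). [folklore] -/
theorem analyticAt_Favg_expCfg (B : E → Site d → Fin d → 𝔸) {t₀ : E}
    (hB : ∀ x κ, AnalyticAt ℂ (fun t => B t x κ) t₀) (L : ℕ) (q : Site d)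
    (hT : ∀ r : Fin d → Fin L, ‖((hol (expCfg (B t₀)) q (treeWord (boxVec L r)) : 𝔸ˣ) : 𝔸) - 1‖ < 1) :
    AnalyticAt ℂ (fun t => Favg L (expCfg (B t)) q) t₀ := by
  unfold Favg
  exact Finset.analyticAt_fun_sum _ fun r _ =>
    ((ExpMeanLog.analyticAt_mlog (hT r)).fun_comp_of_eq (analyticAt_hol_expCfg B hB _ q) rfl).fun_const_smul

/-- The double-bar average `V̿₁(c)` (89)/(120) at `V₀ = 1` is analytic in the bond variables wherever the contour
holonomies entering `X_c`, `F(c₋)`, `F(c₊)` lie in the domain of the series logarithm (21). [folklore] -/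
theorem analyticAt_dbavg_expCfg (B : E → Site d → Fin d → 𝔸) {t₀ : E}
    (hB : ∀ x κ, AnalyticAt ℂ (fun t => B t x κ) t₀) (L : ℕ) (q : Site d) (κ : Fin d)
    (hW : ∀ r : Fin d → Fin L, ‖((Wcx L (expCfg (B t₀)) q κ (boxVec L r) : 𝔸ˣ) : 𝔸) - 1‖ < 1)
    (hT₁ : ∀ r : Fin d → Fin L, ‖((hol (expCfg (B t₀)) q (treeWord (boxVec L r)) : 𝔸ˣ) : 𝔸) - 1‖ < 1)
    (hT₂ : ∀ r : Fin d → Fin L,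
      ‖((hol (expCfg (B t₀)) (q + (L : ℤ) • e κ) (treeWord (boxVec L r)) : 𝔸ˣ) : 𝔸) - 1‖ < 1) :
    AnalyticAt ℂ (fun t => ((dbavg L (expCfg (B t)) q κ : 𝔸ˣ) : 𝔸)) t₀ := by
  simp only [val_dbavg]
  exact (((exp_analytic _).fun_comp_of_eq (analyticAt_Favg_expCfg B hB L q hT₁).neg rfl).fun_mul
    (analyticAt_bavg_expCfg B hB L q κ hW)).fun_mul
      ((exp_analytic _).fun_comp_of_eq (analyticAt_Favg_expCfg B hB L _ hT₂) rfl)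

/-- `(1/i) log V̿₁(c)` is analytic in the bond variables wherever, in addition, `|V̿₁(c) − 1| < 1`. [folklore] -/
theorem analyticAt_mlog_dbavg_expCfg (B : E → Site d → Fin d → 𝔸) {t₀ : E}
    (hB : ∀ x κ, AnalyticAt ℂ (fun t => B t x κ) t₀) (L : ℕ) (q : Site d) (κ : Fin d)
    (hW : ∀ r : Fin d → Fin L, ‖((Wcx L (expCfg (B t₀)) q κ (boxVec L r) : 𝔸ˣ) : 𝔸) - 1‖ < 1)
    (hT₁ : ∀ r : Fin d → Fin L, ‖((hol (expCfg (B t₀)) q (treeWord (boxVec L r)) : 𝔸ˣ) : 𝔸) - 1‖ < 1)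
    (hT₂ : ∀ r : Fin d → Fin L,
      ‖((hol (expCfg (B t₀)) (q + (L : ℤ) • e κ) (treeWord (boxVec L r)) : 𝔸ˣ) : 𝔸) - 1‖ < 1)
    (hD : ‖((dbavg L (expCfg (B t₀)) q κ : 𝔸ˣ) : 𝔸) - 1‖ < 1) :
    AnalyticAt ℂ (fun t => mlog ((dbavg L (expCfg (B t)) q κ : 𝔸ˣ) : 𝔸)) t₀ :=
  (ExpMeanLog.analyticAt_mlog hD).fun_comp_of_eq (analyticAt_dbavg_expCfg B hB L q κ hW hT₁ hT₂) rfl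

/-- THE DOMAIN CONDITIONS FROM THE SMALLNESS OF `A`: if `V_b = e^{A_b}`, `|A_b| ≤ a ≤ c₃(d, L)` on the bonds within
`l¹`-distance `|c₋ − y|₁ + (2d+2)L` of `y`, then every contour holonomy entering `X_c`, `F(c₋)`, `F(c₊)` and `V̿₁(c)` itself
lie within distance `< 1` of `1` ((47): `|W − 1| ≤ 2θ`, `θ = (2d+2)L·a ≤ 1/64`; (120)–(123): `|V̿₁(c) − 1| ≤ 5θ`).
[cite: Balaban1985Averaging, (47) p.25, (26) p.21, (120) p.35] -/
theorem logDomain_of_le_c3 (V : Site d → Fin d → 𝔸ˣ) (A : Site d → Fin d → 𝔸) (y : Site d) (R : ℕ) {a : ℝ}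
    (ha : 0 ≤ a) (hVA : ∀ x κ, l1 (x - y) ≤ R → ((V x κ : 𝔸ˣ) : 𝔸) = exp (A x κ) ∧ ‖A x κ‖ ≤ a)
    (L : ℕ) (hL : 1 ≤ L) (q : Site d) (κ : Fin d) (hR : l1 (q - y) + (2 * (d * L) + L + L) ≤ R)
    (hac : a ≤ c3 d L) :
    (∀ r : Fin d → Fin L, ‖((Wcx L V q κ (boxVec L r) : 𝔸ˣ) : 𝔸) - 1‖ < 1) ∧
    (∀ r : Fin d → Fin L, ‖((hol V q (treeWord (boxVec L r)) : 𝔸ˣ) : 𝔸) - 1‖ < 1) ∧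
    (∀ r : Fin d → Fin L, ‖((hol V (q + (L : ℤ) • e κ) (treeWord (boxVec L r)) : 𝔸ˣ) : 𝔸) - 1‖ < 1) ∧
    ‖((dbavg L V q κ : 𝔸ˣ) : 𝔸) - 1‖ < 1 := by
  have hL1 : (1 : ℝ) ≤ L := by exact_mod_cast hL
  have hcast : ((2 * (d * L) + L + L : ℕ) : ℝ) = 2 * ((d : ℝ) + 1) * L := by push_cast; ring
  set θ : ℝ := ((2 * (d * L) + L + L : ℕ) : ℝ) * a with hθdef
  have hθ0 : 0 ≤ θ := by positivity
  have hθ1 : θ ≤ 1 / 64 := by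
    rw [hθdef, hcast]
    have hpos : (0 : ℝ) < 128 * ((d : ℝ) + 1) * L := by positivity
    have h1 : a * (128 * ((d : ℝ) + 1) * L) ≤ 1 := by
      have := mul_le_mul_of_nonneg_right hac hpos.le
      rwa [c3, one_div, inv_mul_cancel₀ hpos.ne'] at this
    nlinarith
  have hNa : ∀ n : ℕ, n ≤ 2 * (d * L) + L + L → (n : ℝ) * a ≤ θ := fun n hn =>
    mul_le_mul_of_nonneg_right (by exact_mod_cast hn) ha
  -- tree contours from a base point `x` with `|x − y|₁ + dL ≤ R`
  have htree : ∀ x : Site d, l1 (x - y) + d * L ≤ R → ∀ r : Fin d → Fin L,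
      ‖((hol V x (treeWord (boxVec L r)) : 𝔸ˣ) : 𝔸) - 1‖ < 1 := by
    intro x hx r
    have hlen : (treeWord (boxVec L r)).length ≤ d * L := by
      rw [length_treeWord]; exact l1_boxVec_le L r
    obtain ⟨h1, -⟩ := walk_linear V A y R ha hVA (treeWord (boxVec L r)) x (by omega)
    have hna : ((treeWord (boxVec L r)).length : ℝ) * a ≤ θ := hNa _ (by omega)
    exact (h1.trans (exp_sub_one_le_of_le hna hθ0 hθ1)).trans_lt (by linarith)
  have hR' : l1 (q + (L : ℤ) • e κ - y) + d * L ≤ R := by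
    have := l1_add_le (q - y) ((L : ℤ) • e κ)
    rw [l1_zsmul_e, Int.natAbs_natCast, show q - y + (L : ℤ) • e κ = q + (L : ℤ) • e κ - y by abel] at this
    omega
  obtain ⟨-, -, -, -, hWcx⟩ := side_estimate V A y R ha hVA L hL q κ hR le_rfl hθ0 hθ1
  obtain ⟨-, hdb, -⟩ := dbavg_estimate V A y R ha hVA L hL q κ hR le_rfl hθ0 hθ1
  exact ⟨fun r => (hWcx r).trans_lt (by linarith), htree q (by omega), htree _ hR', hdb.trans_lt (by linarith)⟩

/-- **Proposition 3 of B7 at `V₀ = 1` — ANALYTICITY, PROVED for the concrete objects (42)/(110)/(89) on `ℤ^d`**: Prop. 3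
p. 36 "for `α₀, α₁ ≤ c₃` the function `Q(V₀, A) = (1/i) log V̿₁` is an analytic function of `A`" (p. 34: "an analytic
function of the variables `A_b`, `b ⊂ B(c₋)∪B(c₊)`"; p. 20: "a notion of analyticity is well defined and means
analyticity with respect to complex variables `A_a`", the coordinates of `A_b ∈ 𝔤^c`), at the flat background and in the
following precise sense. Let the bond field depend on a parameter `t` ranging over a complex normed space `E`, `A = B(t)`, with every
bond variable `t ↦ B(t)_b` analytic at `t₀` (e.g. `B(t) = Σᵢ tᵢAᵢ`, `t ∈ ℂ^m`, or a complex ray `B(t) = tA`), and suppose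
`|B(t₀)_b| ≤ a ≤ c₃(d, L) = 1/(128(d+1)L)` on the bonds within `l¹`-distance `|c₋ − y|₁ + (2d+2)L` of some `y`. Then
`t ↦ (1/i) log V̿₁(c)[V₁ = e^{B(t)}]` is analytic at `t₀`. (When `𝔸` is finite-dimensional and `B` runs through the affine
families supported on the finitely many bonds of `B(c₋) ∪ B(c₊)` on which `V̿₁(c)` depends — p. 34: "the definition of
`(U̿₁^k)_c` … involves only the gauge fields `U_{1,b}, U_{0,b}` at bonds `b ⊂ B^k(c₋)∪B^k(c₊)`" (p. 31: "the same locality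
properties as the averages `Ū^k`") — this is the printed analyticity on the domain (109) with `α₁ = c₃` (cell shorthand
`𝔤^c(c₃)`, module docstring); the curved background `V₀ ≠ 1` is NOT treated; see DIVERGENCES (a′).)
[cite: Balaban1985Averaging, Prop. 3 p.36, (121) p.36, (109) p.34, p.31, p.20] -/
theorem prop3_flat_analyticAt (B : E → Site d → Fin d → 𝔸) {t₀ : E}
    (hB : ∀ x κ, AnalyticAt ℂ (fun t => B t x κ) t₀) (y : Site d) (R : ℕ) {a : ℝ} (ha : 0 ≤ a)
    (hA : ∀ x κ, l1 (x - y) ≤ R → ‖B t₀ x κ‖ ≤ a)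
    (L : ℕ) (hL : 1 ≤ L) (q : Site d) (κ : Fin d) (hR : l1 (q - y) + (2 * (d * L) + L + L) ≤ R)
    (hac : a ≤ c3 d L) :
    AnalyticAt ℂ (fun t => mlog ((dbavg L (expCfg (B t)) q κ : 𝔸ˣ) : 𝔸)) t₀ := by
  have hVA : ∀ x κ', l1 (x - y) ≤ R →
      ((expCfg (B t₀) x κ' : 𝔸ˣ) : 𝔸) = exp (B t₀ x κ') ∧ ‖B t₀ x κ'‖ ≤ a :=
    fun x κ' hx => ⟨rfl, hA x κ' hx⟩
  obtain ⟨hW, hT₁, hT₂, hD⟩ := logDomain_of_le_c3 (expCfg (B t₀)) (B t₀) y R ha hVA L hL q κ hR hac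
  exact analyticAt_mlog_dbavg_expCfg B hB L q κ hW hT₁ hT₂ hD

/-- `c₃(d, L) ≥ 0`. [folklore] -/
theorem c3_nonneg (d L : ℕ) : 0 ≤ c3 d L := by
  unfold c3; positivity

/-- **Prop. 3 at `V₀ = 1`, analyticity on the whole domain (109) with `α₁ = c₃`** (cell shorthand `𝔤^c(c₃)`; as
`AnalyticOnNhd`): for a parametrised
bond field `B : E → (bonds → 𝔸)` with every bond variable analytic everywhere (e.g. complex-linear families), the map
`t ↦ (1/i) log V̿₁(c)[e^{B(t)}]` is analytic on a neighbourhood of every point of the open set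
`{t : |B(t)_b| < c₃(d, L) for the bonds b within l¹-distance |c₋ − y|₁ + (2d+2)L of y}`.
[cite: Balaban1985Averaging, Prop. 3 p.36] -/
theorem prop3_flat_analyticOnNhd (B : E → Site d → Fin d → 𝔸)
    (hB : ∀ t₀ x κ, AnalyticAt ℂ (fun t => B t x κ) t₀) (y : Site d) (R : ℕ)
    (L : ℕ) (hL : 1 ≤ L) (q : Site d) (κ : Fin d) (hR : l1 (q - y) + (2 * (d * L) + L + L) ≤ R) :
    AnalyticOnNhd ℂ (fun t => mlog ((dbavg L (expCfg (B t)) q κ : 𝔸ˣ) : 𝔸))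
      {t | ∀ x κ', l1 (x - y) ≤ R → ‖B t x κ'‖ < c3 d L} :=
  fun _ ht => prop3_flat_analyticAt B (hB _) y R (c3_nonneg d L) (fun x κ' hx => (ht x κ' hx).le) L hL q κ hR le_rfl

/-- The finite complex-linear families `A(t) = Σ_{i<m} tᵢ Aᵢ`, `t ∈ ℂ^m`, of bond fields (the coordinates of print's
`A ∈ 𝔤^c` along finitely many directions). [folklore] -/
def linCfg {m : ℕ} (A : Fin m → Site d → Fin d → 𝔸) (t : Fin m → ℂ) : Site d → Fin d → 𝔸 :=
  fun x κ => ∑ i, t i • A i x κ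

omit [CompleteSpace 𝔸] in
/-- Each bond variable of a complex-linear family is analytic (indeed linear) in `t ∈ ℂ^m`. [folklore] -/
theorem analyticAt_linCfg {m : ℕ} (A : Fin m → Site d → Fin d → 𝔸) (x : Site d) (κ : Fin d) (t₀ : Fin m → ℂ) :
    AnalyticAt ℂ (fun t => linCfg A t x κ) t₀ :=
  Finset.analyticAt_fun_sum _ fun i _ =>
    ((ContinuousLinearMap.proj (R := ℂ) (φ := fun _ : Fin m => ℂ) i).analyticAt t₀).smul analyticAt_const

/-- **Prop. 3 at `V₀ = 1` in coordinates**: for every finite family of directions `A₀, …, A_{m−1}`, the function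
`(t₁, …, t_m) ↦ (1/i) log V̿₁(c)[e^{Σ tᵢAᵢ}]` of `m` complex variables is (jointly) analytic on the polydomain
`{t ∈ ℂ^m : |Σᵢ tᵢ(Aᵢ)_b| < c₃(d, L) on the bonds of the region}`. [cite: Balaban1985Averaging, Prop. 3 p.36] -/
theorem prop3_flat_analyticOnNhd_linCfg {m : ℕ} (A : Fin m → Site d → Fin d → 𝔸) (y : Site d) (R : ℕ)
    (L : ℕ) (hL : 1 ≤ L) (q : Site d) (κ : Fin d) (hR : l1 (q - y) + (2 * (d * L) + L + L) ≤ R) :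
    AnalyticOnNhd ℂ (fun t : Fin m → ℂ => mlog ((dbavg L (expCfg (linCfg A t)) q κ : 𝔸ˣ) : 𝔸))
      {t | ∀ x κ', l1 (x - y) ≤ R → ‖linCfg A t x κ'‖ < c3 d L} :=
  prop3_flat_analyticOnNhd (linCfg A) (fun t₀ x κ' => analyticAt_linCfg A x κ' t₀) y R L hL q κ hR

/-- **Prop. 3 at `V₀ = 1` along complex rays**: for a bounded bond field `A` (`|A_b| ≤ M`) the function
`t ↦ (1/i) log V̿₁(c)[e^{tA}]` of ONE complex variable is analytic on the disc `M·|t| < c₃(d, L)` (for `M = 0`: on `ℂ`);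
together with `hasDerivAt_mlog_dbavg_ray` (§4) its Taylor expansion at `t = 0` begins with `t·L·(Q₀A)_c` (125).
[cite: Balaban1985Averaging, Prop. 3 + (122)/(125) p.36] -/
theorem prop3_flat_analyticAt_ray (A : Site d → Fin d → 𝔸) {M : ℝ} (hM0 : 0 ≤ M) (hM : ∀ x κ, ‖A x κ‖ ≤ M)
    (L : ℕ) (hL : 1 ≤ L) (q : Site d) (κ : Fin d) (t₀ : ℂ) (ht₀ : M * ‖t₀‖ ≤ c3 d L) :
    AnalyticAt ℂ (fun t : ℂ => mlog ((dbavg L (expCfg (t • A)) q κ : 𝔸ˣ) : 𝔸)) t₀ := by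
  have hB : ∀ x κ', AnalyticAt ℂ (fun t : ℂ => (t • A) x κ') t₀ := fun x κ' => by
    simp only [Pi.smul_apply]
    exact analyticAt_id.smul analyticAt_const
  refine prop3_flat_analyticAt (fun t : ℂ => t • A) hB q (2 * (d * L) + L + L) (a := M * ‖t₀‖) (by positivity)
    (fun x κ' _ => ?_) L hL q κ (by simp [l1]) ht₀
  rw [Pi.smul_apply, Pi.smul_apply, norm_smul, mul_comm]
  exact mul_le_mul_of_nonneg_right (hM x κ') (norm_nonneg _)

/-- **(122)/(125) along COMPLEX rays**: for a bounded bond field `A` the function `t ↦ (1/i) log V̿₁(c)[e^{tA}]` of one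
complex variable — analytic near `0` by `prop3_flat_analyticAt_ray` — has complex derivative `L·(Q₀A)_c` at `t = 0`:
its Taylor expansion begins with the first-order polynomial `t·L·(Q₀A)_c`, print's DEFINITION of `L(Q(V₀)A)_c` in (122),
here `= (125)` (from the real-ray statement `hasDerivAt_mlog_dbavg_ray` of §4 by uniqueness of the real derivative).
[cite: Balaban1985Averaging, (121)–(122) + (125) p.36] -/
theorem hasDerivAt_mlog_dbavg_complexRay (A : Site d → Fin d → 𝔸) {M : ℝ} (hM0 : 0 ≤ M) (hM : ∀ x κ, ‖A x κ‖ ≤ M)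
    (L : ℕ) (hL : 1 ≤ L) (q : Site d) (κ : Fin d) :
    HasDerivAt (fun t : ℂ => mlog ((dbavg L (expCfg (t • A)) q κ : 𝔸ˣ) : 𝔸)) (linQ L A q κ) 0 := by
  set f : ℂ → 𝔸 := fun t : ℂ => mlog ((dbavg L (expCfg (t • A)) q κ : 𝔸ˣ) : 𝔸) with hf
  have han : AnalyticAt ℂ f ((0 : ℝ) : ℂ) :=
    prop3_flat_analyticAt_ray A hM0 hM L hL q κ _ (by simpa using c3_nonneg d L)
  have hC : HasDerivAt f (deriv f ((0 : ℝ) : ℂ)) ((0 : ℝ) : ℂ) := han.differentiableAt.hasDerivAt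
  have hR : HasDerivAt (f ∘ ((↑) : ℝ → ℂ)) (Complex.ofRealCLM 1 • deriv f ((0 : ℝ) : ℂ)) 0 :=
    hC.scomp (0 : ℝ) Complex.ofRealCLM.hasDerivAt
  have hsmul : ∀ s : ℝ, ((s : ℂ) • A : Site d → Fin d → 𝔸) = s • A := fun s => by
    funext x κ'
    simp only [Pi.smul_apply, Complex.coe_smul]
  have hfun : f ∘ ((↑) : ℝ → ℂ) = fun s : ℝ => mlog ((dbavg L (expCfg (s • A)) q κ : 𝔸ˣ) : 𝔸) := by
    funext s
    simp only [Function.comp_apply, hf, hsmul]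
  rw [hfun] at hR
  simp only [Complex.ofRealCLM_apply, Complex.ofReal_one, one_smul, Complex.ofReal_zero] at hR hC
  have hu : linQ L A q κ = deriv f 0 := (hasDerivAt_mlog_dbavg_ray A hM0 hM L hL q κ).unique hR
  rw [hu]
  exact hC

/-- `c₃(d, L) > 0` for `L ≥ 1`. [folklore] -/
theorem c3_pos (d : ℕ) {L : ℕ} (hL : 1 ≤ L) : 0 < c3 d L := by
  have : (0 : ℝ) < L := by exact_mod_cast hL
  unfold c3; positivity

/-- INSERTION OF FINITELY MANY BOND VARIABLES: the bond field on `ℤ^d` equal to `a_b` on the bonds `b` of a finite set `S`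
and to `0` elsewhere (so `e^{A} = 1` off `S`: all other bond variables frozen at the unit). Print's "the variables `A_b`,
`b ⊂ B(c₋)∪B(c₊)`" (p. 34, the sentence after (109); `A_b ∈ 𝔤^c`) is the case `S ⊇` those bonds.
[cite: Balaban1985Averaging, (109) p.34, p.31] -/
def insCfg (S : Finset (Site d × Fin d)) (a : S → 𝔸) : Site d → Fin d → 𝔸 :=
  fun x κ => if h : (x, κ) ∈ S then a ⟨(x, κ), h⟩ else 0

omit [CompleteSpace 𝔸] in
/-- Each bond variable of the inserted field is an analytic (coordinate or zero) function of `a ∈ 𝔸^S`. [folklore] -/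
theorem analyticAt_insCfg (S : Finset (Site d × Fin d)) (x : Site d) (κ : Fin d) (a₀ : S → 𝔸) :
    AnalyticAt ℂ (fun a : S → 𝔸 => insCfg S a x κ) a₀ := by
  by_cases h : (x, κ) ∈ S
  · simp only [insCfg, h, dite_true]
    exact (ContinuousLinearMap.proj (R := ℂ) (φ := fun _ : S => 𝔸) ⟨(x, κ), h⟩).analyticAt a₀
  · simp only [insCfg, h, dite_false]
    exact analyticAt_const

omit [NormedAlgebra ℂ 𝔸] [CompleteSpace 𝔸] in
/-- Off `S` the inserted field vanishes, on `S` it is the coordinate; hence a strict bound `‖a_s‖ < r` (`r > 0`) on the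
coordinates is a strict bound on every bond variable of the inserted field. [folklore] -/
theorem norm_insCfg_lt (S : Finset (Site d × Fin d)) {a : S → 𝔸} {r : ℝ} (hr : 0 < r) (ha : ∀ s, ‖a s‖ < r)
    (x : Site d) (κ : Fin d) : ‖insCfg S a x κ‖ < r := by
  by_cases h : (x, κ) ∈ S
  · simp only [insCfg, h, dite_true]; exact ha _
  · simp only [insCfg, h, dite_false, norm_zero]; exact hr

/-- **Prop. 3 at `V₀ = 1`, LITERALLY p. 34's "`(V̿₁)_c` is an analytic function of the variables `A_b`, `b ⊂ B(c₋)∪B(c₊)`"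
(for its logarithm (121); Prop. 3: "is an analytic function of `A`") on the polydisc `|A_b| < c₃` = (109) with `α₁ = c₃`
(cell shorthand `𝔤^c(c₃)`)**: for every finite set `S` of bonds of `ℤ^d`,
the function `𝔸^S → 𝔸`, `(A_b)_{b∈S} ↦ (1/i) log V̿₁(c)[V₁ = e^{A} on S, V₁ = 1 off S]`, is analytic on a neighbourhood of
every point of the open polydisc `{∀ b ∈ S, |A_b| < c₃(d, L)}` (`c₃ = 1/(128(d+1)L)`); with `S ⊇` the bonds of
`B(c₋) ∪ B(c₊)` — the only bond variables `V̿₁(c)` depends on (pp. 31, 34) — this is the printed clause at the flat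
background. [cite: Balaban1985Averaging, Prop. 3 p.36, (121) p.36, (109) p.34, p.31] -/
theorem prop3_flat_analyticOnNhd_ins (S : Finset (Site d × Fin d)) (L : ℕ) (hL : 1 ≤ L) (q : Site d) (κ : Fin d) :
    AnalyticOnNhd ℂ (fun a : S → 𝔸 => mlog ((dbavg L (expCfg (insCfg S a)) q κ : 𝔸ˣ) : 𝔸))
      {a | ∀ s, ‖a s‖ < c3 d L} :=
  (prop3_flat_analyticOnNhd (insCfg S) (fun a₀ x κ' => analyticAt_insCfg S x κ' a₀) q (2 * (d * L) + L + L)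
    L hL q κ (by simp [l1])).mono
    fun _ ha x κ' _ => norm_insCfg_lt S (c3_pos d hL) ha x κ'

/-! ### (122) in Fréchet form on `𝔸^S` (v1.3)

On the finite-dimensional-in-the-bonds parameter space `𝔸^S` of v1.2 the map `A ↦ Q(1, A, c) = (1/i) log V̿₁(c)` HAS a
Fréchet derivative at `A = 0`, and it is the linear form `A ↦ L·(Q₀A)_c` of (122)/(125); consequently
`C(1, A, c) := Q(1, A, c) − L·(Q₀A)_c` is analytic on the polydisc, vanishes at `0` and has zero derivative at `0` — the
printed "`C(V₀, A, c)` is an analytic function of `A` whose Taylor's expansion begins with a second-order polynomial"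
(Prop. 3, p. 36) at `V₀ = 1`, now as a statement about the 1-jet and not only along rays. -/

omit [CompleteSpace 𝔸] in
/-- `stepA` is `ℂ`-linear in the field — bookkeeping. [folklore] -/
theorem stepA_csmul (t : ℂ) (A : Site d → Fin d → 𝔸) (x : Site d) (l : Letter d) :
    stepA (t • A) x l = t • stepA A x l := by
  obtain ⟨μ, b⟩ := l
  cases b
  · simp [stepA_false, smul_neg]
  · simp [stepA_true]

omit [CompleteSpace 𝔸] in
/-- `A ↦ A(Γ)` is `ℂ`-linear: `(tA)(Γ) = t·A(Γ)`, `t ∈ ℂ` — bookkeeping. [folklore] -/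
theorem asum_csmul (t : ℂ) (A : Site d → Fin d → 𝔸) :
    ∀ (x : Site d) (w : List (Letter d)), asum (t • A) x w = t • asum A x w
  | x, [] => by simp
  | x, l :: w => by rw [asum_cons, asum_cons, asum_csmul t A _ w, stepA_csmul, smul_add]

omit [CompleteSpace 𝔸] in
/-- `L·(Q₀(tA))_c = t·L·(Q₀A)_c` for COMPLEX `t`: (125) is a `ℂ`-linear form in `A`. [cite: Balaban1985Averaging, (125) p.36] -/
theorem linQ_csmul (L : ℕ) (t : ℂ) (A : Site d → Fin d → 𝔸) (q : Site d) (κ : Fin d) :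
    linQ L (t • A) q κ = t • linQ L A q κ := by
  simp only [linQ, asum_csmul, Finset.smul_sum, smul_comm t]

omit [CompleteSpace 𝔸] in
/-- `A(Γ)` is analytic in any analytic parametrisation of the bond variables (finite signed sum). [folklore] -/
theorem analyticAt_asum (B : E → Site d → Fin d → 𝔸) {t₀ : E} (hB : ∀ x κ, AnalyticAt ℂ (fun t => B t x κ) t₀) :
    ∀ (w : List (Letter d)) (x : Site d), AnalyticAt ℂ (fun t => asum (B t) x w) t₀
  | [], x => by simpa using analyticAt_const
  | (μ, true) :: w, x => by
      simp only [asum_cons, stepA_true]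
      exact (hB x μ).fun_add (analyticAt_asum B hB w _)
  | (μ, false) :: w, x => by
      simp only [asum_cons, stepA_false]
      exact (hB _ μ).neg.fun_add (analyticAt_asum B hB w _)

omit [CompleteSpace 𝔸] in
/-- The main term `L·(Q₀A)_c` (125) is analytic in any analytic parametrisation of the bond variables (finite sum of
real multiples of the `A(Γ)`). [cite: Balaban1985Averaging, (125) p.36] -/
theorem analyticAt_linQ (B : E → Site d → Fin d → 𝔸) {t₀ : E} (hB : ∀ x κ, AnalyticAt ℂ (fun t => B t x κ) t₀)
    (L : ℕ) (q : Site d) (κ : Fin d) : AnalyticAt ℂ (fun t => linQ L (B t) q κ) t₀ := by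
  unfold linQ
  exact Finset.analyticAt_fun_sum _ fun r _ => (analyticAt_asum B hB _ _).fun_const_smul

omit [CompleteSpace 𝔸] in
/-- The insertion map `𝔸^S → bond fields` is `ℂ`-linear (homogeneity) — bookkeeping. [folklore] -/
theorem insCfg_smul (S : Finset (Site d × Fin d)) (t : ℂ) (v : S → 𝔸) :
    insCfg S (t • v) = t • insCfg S v := by
  funext x κ
  by_cases h : (x, κ) ∈ S <;> simp [insCfg, h]

omit [NormedAlgebra ℂ 𝔸] [CompleteSpace 𝔸] in
/-- `insCfg S 0 = 0` (the unit configuration `e^0 = 1`) — bookkeeping. [folklore] -/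
theorem insCfg_zero (S : Finset (Site d × Fin d)) : insCfg S (0 : S → 𝔸) = 0 := by
  funext x κ
  by_cases h : (x, κ) ∈ S <;> simp [insCfg, h]

omit [NormedAlgebra ℂ 𝔸] [CompleteSpace 𝔸] in
/-- Every bond variable of the inserted field is bounded by the sup-norm of `a ∈ 𝔸^S` — bookkeeping. [folklore] -/
theorem norm_insCfg_le (S : Finset (Site d × Fin d)) (v : S → 𝔸) (x : Site d) (κ : Fin d) :
    ‖insCfg S v x κ‖ ≤ ‖v‖ := by
  by_cases h : (x, κ) ∈ S
  · simp only [insCfg, h, dite_true]; exact norm_le_pi_norm v _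
  · simp only [insCfg, h, dite_false, norm_zero]; exact norm_nonneg _

/-- Directional (complex) derivative of `A ↦ (1/i) log V̿₁(c)` at `A = 0` on `𝔸^S` in the direction `v`: it is
`L·(Q₀ v)_c` (v1.1 `hasDerivAt_mlog_dbavg_complexRay` transported through the insertion). [cite: Balaban1985Averaging, (122) + (125) p.36] -/
theorem hasDerivAt_mlog_dbavg_ins_dir (S : Finset (Site d × Fin d)) (L : ℕ) (hL : 1 ≤ L) (q : Site d) (κ : Fin d)
    (v : S → 𝔸) :
    HasDerivAt (fun t : ℂ => mlog ((dbavg L (expCfg (insCfg S (t • v))) q κ : 𝔸ˣ) : 𝔸))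
      (linQ L (insCfg S v) q κ) 0 := by
  simp only [insCfg_smul]
  exact hasDerivAt_mlog_dbavg_complexRay (insCfg S v) (norm_nonneg v) (norm_insCfg_le S v) L hL q κ

/-- **(122) in Fréchet form at `V₀ = 1`**: on `𝔸^S` the map `A ↦ Q(1, A, c) = (1/i) log V̿₁(c)` is Fréchet-differentiable
at `A = 0` and its derivative there is the continuous linear form `A ↦ L·(Q₀A)_c` — "its Taylor expansion begins with a
first-order polynomial and we will prove that (122) holds" with the first-order polynomial `L(Q(V₀)A)_c = L·(Q₀A)_c`
(READING C-adv4-22; flat background). [cite: Balaban1985Averaging, (121)–(122) + (125) p.36] -/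
theorem hasFDerivAt_mlog_dbavg_ins (S : Finset (Site d × Fin d)) (L : ℕ) (hL : 1 ≤ L) (q : Site d) (κ : Fin d) :
    ∃ Λ : (S → 𝔸) →L[ℂ] 𝔸,
      HasFDerivAt (fun a : S → 𝔸 => mlog ((dbavg L (expCfg (insCfg S a)) q κ : 𝔸ˣ) : 𝔸)) Λ 0 ∧
        ∀ v, Λ v = linQ L (insCfg S v) q κ := by
  set f : (S → 𝔸) → 𝔸 := fun a => mlog ((dbavg L (expCfg (insCfg S a)) q κ : 𝔸ˣ) : 𝔸) with hf
  have han : AnalyticAt ℂ f 0 :=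
    prop3_flat_analyticOnNhd_ins S L hL q κ 0 fun s => by simpa using c3_pos d hL
  have hF : HasFDerivAt f (fderiv ℂ f 0) 0 := han.differentiableAt.hasFDerivAt
  refine ⟨fderiv ℂ f 0, hF, fun v => ?_⟩
  have hg : HasDerivAt (fun t : ℂ => t • v) v 0 := by
    simpa using (hasDerivAt_id (0 : ℂ)).smul_const v
  have hF' : HasFDerivAt f (fderiv ℂ f 0) ((0 : ℂ) • v) := by rwa [zero_smul]
  have h1 : HasDerivAt (f ∘ fun t : ℂ => t • v) (fderiv ℂ f 0 v) 0 := hF'.comp_hasDerivAt (0 : ℂ) hg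
  exact h1.unique (hasDerivAt_mlog_dbavg_ins_dir S L hL q κ v)

omit [CompleteSpace 𝔸] in
/-- The main term `A ↦ L·(Q₀A)_c` on `𝔸^S` is its own Fréchet derivative at `0` (it is a continuous linear form).
[cite: Balaban1985Averaging, (125) p.36] -/
theorem hasFDerivAt_linQ_ins (S : Finset (Site d × Fin d)) (L : ℕ) (q : Site d) (κ : Fin d) :
    ∃ Λ : (S → 𝔸) →L[ℂ] 𝔸,
      HasFDerivAt (fun a : S → 𝔸 => linQ L (insCfg S a) q κ) Λ 0 ∧ ∀ v, Λ v = linQ L (insCfg S v) q κ := by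
  set g : (S → 𝔸) → 𝔸 := fun a => linQ L (insCfg S a) q κ with hg
  have han : AnalyticAt ℂ g 0 := analyticAt_linQ (insCfg S) (fun x κ' => analyticAt_insCfg S x κ' 0) L q κ
  have hG : HasFDerivAt g (fderiv ℂ g 0) 0 := han.differentiableAt.hasFDerivAt
  refine ⟨fderiv ℂ g 0, hG, fun v => ?_⟩
  have hs : HasDerivAt (fun t : ℂ => t • v) v 0 := by
    simpa using (hasDerivAt_id (0 : ℂ)).smul_const v
  have hG' : HasFDerivAt g (fderiv ℂ g 0) ((0 : ℂ) • v) := by rwa [zero_smul]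
  have h1 : HasDerivAt (g ∘ fun t : ℂ => t • v) (fderiv ℂ g 0 v) 0 := hG'.comp_hasDerivAt (0 : ℂ) hs
  have h2 : HasDerivAt (fun t : ℂ => linQ L (insCfg S (t • v)) q κ) (linQ L (insCfg S v) q κ) 0 := by
    simp only [insCfg_smul, linQ_csmul]
    simpa using (hasDerivAt_id (0 : ℂ)).smul_const (linQ L (insCfg S v) q κ)
  exact h1.unique h2

/-- **Prop. 3 at `V₀ = 1`, the remainder `C`**: on `𝔸^S`, `C(1, A, c) := (1/i) log V̿₁(c) − L·(Q₀A)_c` is analytic on a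
neighbourhood of every point of the polydisc `{|A_b| < c₃(d, L)}`, `C(1, 0, c) = 0`, and its Fréchet derivative at
`A = 0` VANISHES — "`C(V₀, A, c)` is an analytic function of `A` whose Taylor's expansion begins with a second-order
polynomial" (with the bound `|C| ≤ C₁L²|A|²` of (123), v1 `prop3_flat`). [cite: Balaban1985Averaging, Prop. 3 p.36, (122)–(123) p.36] -/
theorem prop3_flat_C_ins (S : Finset (Site d × Fin d)) (L : ℕ) (hL : 1 ≤ L) (q : Site d) (κ : Fin d) :
    AnalyticOnNhd ℂ
        (fun a : S → 𝔸 => mlog ((dbavg L (expCfg (insCfg S a)) q κ : 𝔸ˣ) : 𝔸) - linQ L (insCfg S a) q κ)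
        {a | ∀ s, ‖a s‖ < c3 d L} ∧
      (mlog ((dbavg L (expCfg (insCfg S (0 : S → 𝔸))) q κ : 𝔸ˣ) : 𝔸) - linQ L (insCfg S (0 : S → 𝔸)) q κ
          = 0) ∧
      HasFDerivAt
        (fun a : S → 𝔸 => mlog ((dbavg L (expCfg (insCfg S a)) q κ : 𝔸ˣ) : 𝔸) - linQ L (insCfg S a) q κ)
        (0 : (S → 𝔸) →L[ℂ] 𝔸) 0 := by
  refine ⟨?_, ?_, ?_⟩
  · exact (prop3_flat_analyticOnNhd_ins S L hL q κ).sub fun a _ =>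
      analyticAt_linQ (insCfg S) (fun x κ' => analyticAt_insCfg S x κ' a) L q κ
  · have h0 : linQ L (0 : Site d → Fin d → 𝔸) q κ = 0 := by
      simpa using linQ_csmul L (0 : ℂ) (0 : Site d → Fin d → 𝔸) q κ
    rw [insCfg_zero, mlog_dbavg_zero L hL q κ, h0, sub_zero]
  · obtain ⟨Λ, hF, hΛ⟩ := hasFDerivAt_mlog_dbavg_ins (𝔸 := 𝔸) S L hL q κ
    obtain ⟨Λ', hG, hΛ'⟩ := hasFDerivAt_linQ_ins (𝔸 := 𝔸) S L q κ
    have hΛΛ' : Λ - Λ' = 0 := by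
      rw [sub_eq_zero]; exact ContinuousLinearMap.ext fun v => by rw [hΛ, hΛ']
    have h := hF.fun_sub hG
    rw [hΛΛ'] at h
    exact h

end Analytic

end Literature.MathematicalPhysics.QuantumFieldTheory.Balaban1983to89.B7Prop3Flat
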